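import Summits.ResolutionOfSingularities.ResolutionOfSingularities.Theses.Valuative
import Summits.ResolutionOfSingularities.ResolutionOfSingularities.Theses.CyclicCovers
import Literature.AlgebraicGeometry.Resolution.ResolutionLU
import Literature.AlgebraicGeometry.Resolution.RegularLocalRingsNormal
import Literature.AlgebraicGeometry.Resolution.LocalUniformizationDimOne
import Literature.AlgebraicGeometry.Resolution.AffineDomainDimension
import Literature.AlgebraicGeometry.Resolution.ExcellentRingsFieldProofs
import Literature.Barriers.ResolutionOfSingularities.QuasiExcellenceNecessaryNagataProofs
import Literature.Barriers.ResolutionOfSingularities.InseparableBaseChange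
import Literature.AlgebraicGeometry.Resolution.AbhyankarEtaleAscentProofs
import Literature.AlgebraicGeometry.Resolution.SmoothImpliesRegular
import Mathlib.RingTheory.MvPowerSeries.NoZeroDivisors
import Mathlib.RingTheory.MvPowerSeries.Order
import Mathlib.RingTheory.Valuation.ExtendToLocalization
import Mathlib.Algebra.MvPolynomial.PDeriv
import Mathlib.FieldTheory.Finite.Polynomial
import Mathlib.RingTheory.Derivation.Basic
import Mathlib.RingTheory.RegularLocalRing.Polynomial
import Mathlib.FieldTheory.IntermediateField.Adjoin.Basic
import Mathlib.RingTheory.Polynomial.UniqueFactorization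

/-!
# Disproof work file — crux `LuAlphaPTorsor` (stmt-ResolutionOfSingularities-0641)

Standing adversary (cdisprove, gen 2 → gen 3, 2026-08-16) on the crux of routes `Valuative` / `CyclicCovers`:

> `LuAlphaPTorsor`: for every prime `p`, field `k` of characteristic `p`, valuation ring `O` of
> `K ⊇ k`, finitely generated `A₀ ⊆ O` regular at the centre `𝔪_O ∩ A₀`, and `t ∈ K` with
> `t ^ p ∈ A₀`, `Frac (A₀[t]) = K`: some finitely generated `A ⊇ A₀[t]` inside `O` with
> `Frac A = K` is regular at the centre.

## Findings (index; every `theorem` is kernel-checked: rc 0, NO `sorry`, axioms ⊆ {propext, choice, Quot.sound})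

§0 `At p` — the crux at one prime; `luAlphaPTorsor_iff : LuAlphaPTorsor ↔ ∀ p prime, At p`;
   `cyclicCovers_luAlphaPTorsor_iff` — route `CyclicCovers`' copy is the same proposition.

§1 POSITION (why it resists). `at_of_relLU`, `at_of_resolutionInChar`,
   `luAlphaPTorsor_of_resolutionOfSingularities : ResolutionOfSingularities → LuAlphaPTorsor`:
   the crux is IMPLIED BY THE SUMMIT (through the tree's `ResolutionInChar.relLocalUniformization`,
   Zariski 1940 read backwards). A refutation of the crux is therefore a refutation of resolution
   of singularities in characteristic `p` — nobody has one; all printed negative results of the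
   area are barriers for METHODS or for STRENGTHENINGS (§4, §5), not counterexamples.

§2 LOAD-BEARING HYPOTHESES (drop one, keep the rest):
   * `not_withoutFrac`  — drop `Frac (A₀[t]) = K`: FALSE (bookkeeping: `K` need not be finitely
     generated; witness `k = 𝔽_p`, `K = 𝔽_p^alg`, `O = K`, `A₀ = k`, `t = 0`).
   * `not_withoutFG`    — drop `A₀.FG`: FALSE (witness `K = 𝔽_p(X)`, `A₀ = O = K`, `t = 0`;
     Zariski's lemma: a field finitely generated as an algebra is finite, `X` is transcendental).
   * `not_withoutTorsor` — drop `t ^ p ∈ A₀`: FALSE FOR A JUNK REASON (`t ∉ O` becomes possible: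
     `K = 𝔽_p(X)`, `O = O_∞`, `t = X`); the honest mutation (`t ∈ O`, arbitrary `t`) sits between
     the crux and relative LU (`withoutTorsorMemO_of_relLU`, `at_of_withoutTorsorMemO`): open.
   * `withoutRegular_iff_relLU`, `withoutRegular_iff_lurel` — drop regularity of the base: the
     statement becomes EXACTLY relative local uniformization in characteristic `p`, i.e. the
     route's own `LUrel_p` (`Lurel p`, first conjunct of `ValuativeThesisRel`, `valuativeThesisRel_iff`,
     `lurel_iff_relLU`); open (trdeg ≥ 4), not refutable.
   So the two hypotheses that carry mathematics (`t ^ p ∈ A₀`, regular base) cannot be shown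
   necessary by counterexample: dropping either lands on an OPEN statement implied by the summit.

§3 TRUE CASES (no junk falsity; where a counterexample canNOT live):
   * `case_mem` (`t ∈ A₀`), `case_top` (`O = K`);
   * `case_frac` — the birational case `Frac A₀ = K` (i.e. `t ∈ Frac A₀`) is TRUE with `A := A₀[t]`
     (regular ⇒ normal, Matsumura 19.4, PROVED in the tree), so the live content is `t ∉ Frac A₀`;
   * `concl_of_trdeg_le_one` / `at_trdeg_le_one` — TRUE unconditionally for `trdeg_k K ≤ 1`, every
     `k` (excellent curves: LU = finite normalisation, tree `LocalUniformizationDimOne`);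
   * `concl_of_trdeg_le_three` — TRUE for `trdeg_k K ≤ 3` conditionally on the vendored fact
     `CossartPiltant2019`. A counterexample needs `trdeg ≥ 2` outright, `≥ 4` modulo CP2019.
   * `concl_of_isAbhyankarPlace` (§3d, gen 3) — TRUE UNCONDITIONALLY along every ABHYANKAR place
     `O` of `K/k` (equality in Abhyankar's inequality) with separably generated residue extension,
     in EVERY dimension: the tree proves Knaf–Kuhlmann 2005 Thm 1.1 (`KnafKuhlmann2005_Thm11_holds`,
     axioms checked: propext/choice/Quot.sound only) and "smooth ⇒ regular"; neither the regular
     base nor the torsor shape is used. So a counterexample needs a NON-Abhyankar valuation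
     (rank + rational rank + residual trdeg deficient: the valuations with room for DEFECT).
   * `conclWithoutFG_of_isDiscreteValuationRing` (§3f, gen 3) — dropping `A.FG` from the
     CONCLUSION makes it trivially true along every DISCRETE rank-one `O` (junk model `A := O`,
     a DVR): the finite generation of the model is what excludes `O` itself.
   * `concl_of_resolutionInChar`, `concl_charZero_of_hironaka` (§3e) — the Kummer/char-0 twins
     (any exponent `n`, any characteristic) follow from resolution in that characteristic; char 0
     is a theorem mod `Hironaka1964`. `frac_conjunct_redundant`: `IsFractionRing A K` in the
     conclusion is implied by `A₀ ≤ A ∧ t ∈ A`.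

§4 FALSE NATURAL STRENGTHENINGS (each refuted by an explicit witness):
   * `not_sameModel` — "no blow-up needed" (`A := A₀[t]` regular at the centre) is FALSE for EVERY
     `p`: `A₀ = 𝔽_p[X^p]`, `t = X^(p+1)`, `O` = `X`-adic; `𝔽_p[X^p, X^(p+1)]` is singular at `0`.
   * `not_torsorOverDVR` — the crux over an ARBITRARY regular base (a char-`p` DVR `S`, `t^p ∈ S`,
     `A` finitely generated over `S`) is FALSE: Schmidt–Nagata DVR (tree, PROVED). EXCELLENCE OF THE
     BASE IS LOAD-BEARING — a proof must use "finite type over a field", not only "regular";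
     and the dividing line is exact: `torsorOverDVR_of_isExcellent` — the same statement is TRUE
     for an EXCELLENT DVR base (finite normalisation of excellent curves, tree).
   * `not_geomReducedModel` — "the model is geometrically reduced / smooth over `k`" is FALSE over
     imperfect `k` (`k = 𝔽_p(s)`, `K = k(s^{1/p})`; tree barrier `InseparableBaseChange`): the
     crux is right to conclude REGULAR only.
   * `not_finiteModel` (§4d, gen 3) — "NORMALISING suffices" (a model `A` INTEGRAL over `A₀`,
     i.e. inside the normalisation of `A₀[t]`) is FALSE for EVERY `p`, already for `trdeg 2` and a
     monomial (Abhyankar, defectless) valuation: `A₀ = 𝔽_p[x,y]`, `t^p = xy` — `A₀[t] =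
     𝔽_p[u^p, v^p, uv]` is the NORMAL `A_{p-1}` singularity, so `A = A₀[t]`, not regular at the
     centre of `v(u), v(v) = exp(-2), exp(-1)` (`x ∉ 𝔪²` by the auxiliary weights `(1,p)`;
     `Λ/xΛ` regular ⇒ domain ⇒ `t ∈ xΛ` ⇒ `v(t) ≤ v(x)`, false). With `not_sameModel`: the proof
     must BLOW UP THE BASE. (Fully formalised: monomial valuations from `weightedOrder`, normality
     via the Euler derivation `u∂ᵤ − v∂ᵥ`, Matsumura 14.2/14.3 from the tree.)
   Printed, not formalised here: monomialisation-type strengthenings fail in char `p` (Cutkosky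
   2014 Thm 1.4, barrier `LocalMonomializationFails`, PROVED data in tree).

§5 LITERATURE (negative results in print; see the closing docblock): none refutes the crux; all are
   method barriers (residual order unbounded — Moh/Hauser–Perlega; kangaroo points; ELU unknown in
   dim 4 — Cutkosky–Mourtada 2019 p.4; Temkin 2013 Rem 1.5(iii) "all bad things happen"), catalogued
   under `Literature/Barriers/ResolutionOfSingularities/`.
§6 TARGETS (gen 3, closing docblock before §5): the registered line `pbasis-flag-order-p-quotients` —
   what §§3–4 force on its stubs, the printed status of its `FinalForms` (Posva 2024: dim 2 known via
   Giraud = the crux side; dim 3 rank one: `p = 2` schematic, `p > 2` stacky/open), `p`-closedness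
   load-bearing in `FreeExit`, and the dim-2 point-blow-up DFS computation (kit job id there).
-/

noncomputable section

set_option linter.dupNamespace false

open IsLocalRing

namespace Summit.ResolutionOfSingularities.ResolutionOfSingularities.Cruxes.LuAlphaPTorsor.Disproof

open Summit.ResolutionOfSingularities.ResolutionOfSingularities.Theses.Valuative (LuAlphaPTorsor)
open Literature.AlgebraicGeometry.Resolution (RelLocalUniformization ResolutionInChar
  exists_affineModel isFractionRing_of_le)

/-! ## §0 The crux at one prime -/

/-- The crux `LuAlphaPTorsor` at a fixed prime `p` (body copied verbatim). -/
def At (p : ℕ) : Prop :=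
  ∀ (k K : Type) [Field k] [CharP k p] [Field K] [Algebra k K] (O : ValuationSubring K)
    (A₀ : Subalgebra k K) (h₀ : A₀.toSubring ≤ O.toSubring) (t : K), A₀.FG → t ^ p ∈ A₀ →
    IsFractionRing (Algebra.adjoin k (insert t (A₀ : Set K))) K →
    IsRegularLocalRing (Localization.AtPrime (Ideal.comap (Subring.inclusion h₀)
      (IsLocalRing.maximalIdeal O))) →
    ∃ (A : Subalgebra k K) (h : A.toSubring ≤ O.toSubring), A₀ ≤ A ∧ t ∈ A ∧ A.FG ∧
      IsFractionRing A K ∧ IsRegularLocalRing (Localization.AtPrime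
        (Ideal.comap (Subring.inclusion h) (IsLocalRing.maximalIdeal O)))

/-- `LuAlphaPTorsor` is the conjunction of `At p` over the primes (definitional). -/
theorem luAlphaPTorsor_iff : LuAlphaPTorsor ↔ ∀ p : ℕ, p.Prime → At p := Iff.rfl

/-- The copy of the crux in route `CyclicCovers` (same item stmt-0641, rank 5 there) is the same
proposition (definitional), so everything below applies to both routes. -/
theorem cyclicCovers_luAlphaPTorsor_iff :
    Summit.ResolutionOfSingularities.ResolutionOfSingularities.Theses.CyclicCovers.LuAlphaPTorsor ↔
      LuAlphaPTorsor :=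
  Iff.rfl

/-! ## Helpers -/

section Helpers

variable {k K : Type} [Field k] [Field K] [Algebra k K]

/-- Valuation rings are integrally closed, in the only form needed: `t ^ n ∈ O ⇒ t ∈ O`. -/
theorem mem_of_pow_mem (O : ValuationSubring K) {t : K} {n : ℕ} (hn : n ≠ 0) (h : t ^ n ∈ O) :
    t ∈ O := by
  rw [← O.valuation_le_one_iff] at h ⊢
  rw [map_pow] at h
  by_contra hlt
  exact (one_lt_pow₀ (lt_of_not_ge hlt) hn).not_ge h

/-- `A₀[t] ⊆ O` as soon as `A₀ ⊆ O` and `t ∈ O`. -/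
theorem adjoin_insert_le (O : ValuationSubring K) (A₀ : Subalgebra k K)
    (h₀ : A₀.toSubring ≤ O.toSubring) {t : K} (ht : t ∈ O) :
    (Algebra.adjoin k (insert t (A₀ : Set K))).toSubring ≤ O.toSubring := by
  let Oalg : Subalgebra k K :=
    { O.toSubring with algebraMap_mem' := fun c => h₀ (A₀.algebraMap_mem c) }
  change Algebra.adjoin k (insert t (A₀ : Set K)) ≤ Oalg
  refine Algebra.adjoin_le ?_
  rintro x (rfl | hx)
  · exact ht
  · exact h₀ hx

/-- `A₀ ≤ A₀[t]`. -/
theorem le_adjoin_insert (A₀ : Subalgebra k K) (t : K) :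
    A₀ ≤ Algebra.adjoin k (insert t (A₀ : Set K)) :=
  fun _ hx => Algebra.subset_adjoin (Set.mem_insert_of_mem _ hx)

/-- `t ∈ A₀[t]`. -/
theorem mem_adjoin_insert (A₀ : Subalgebra k K) (t : K) :
    t ∈ Algebra.adjoin k (insert t (A₀ : Set K)) :=
  Algebra.subset_adjoin (Set.mem_insert _ _)

/-- `A₀[t]` is finitely generated when `A₀` is. -/
theorem fg_adjoin_insert {A₀ : Subalgebra k K} (hfg : A₀.FG) (t : K) :
    (Algebra.adjoin k (insert t (A₀ : Set K))).FG := by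
  classical
  obtain ⟨s, rfl⟩ := hfg
  rw [Algebra.adjoin_insert_adjoin, ← Finset.coe_insert]
  exact Subalgebra.fg_adjoin_finset _

/-- The localisation of a Noetherian domain at the zero ideal is a regular local ring (it is a
field). -/
theorem isRegularLocalRing_localization_of_eq_bot {R : Type*} [CommRing R] [IsDomain R]
    [IsNoetherianRing R] (I : Ideal R) [I.IsPrime] (hI : I = ⊥) :
    IsRegularLocalRing (Localization.AtPrime I) := by
  subst hI
  apply IsRegularLocalRing.of_spanFinrank_maximalIdeal_le
  have hm : maximalIdeal (Localization.AtPrime (⊥ : Ideal R)) = ⊥ := by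
    rw [← Localization.AtPrime.map_eq_maximalIdeal, Ideal.map_bot]
  rw [hm, Submodule.spanFinrank_bot]
  exact ringKrullDim_nonneg_of_nontrivial

/-- The centre of the trivial valuation ring `O = K` on any model is the zero ideal. -/
theorem centre_top_eq_bot (A : Subalgebra k K)
    (h : A.toSubring ≤ (⊤ : ValuationSubring K).toSubring) :
    Ideal.comap (Subring.inclusion h) (maximalIdeal (⊤ : ValuationSubring K)) = ⊥ := by
  rw [maximalIdeal_eq_bot, Ideal.comap_bot_of_injective]
  exact Subring.inclusion_injective _

/-- A prime ideal of the bottom subalgebra `k ⊆ K` (a field) is zero. -/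
theorem ideal_bot_eq_bot (I : Ideal (⊥ : Subalgebra k K).toSubring) (hI : I ≠ ⊤) : I = ⊥ := by
  refine (Submodule.eq_bot_iff _).mpr fun x hx => ?_
  by_contra hx0
  apply hI
  refine Ideal.eq_top_of_isUnit_mem _ hx ?_
  have hxmem : (x : K) ∈ (⊥ : Subalgebra k K) := x.2
  rw [Algebra.mem_bot] at hxmem
  obtain ⟨c, hc⟩ := hxmem
  have hc0 : c ≠ 0 := by
    rintro rfl
    apply hx0
    apply Subtype.ext
    simp [← hc]
  have hinv : algebraMap k K c⁻¹ ∈ (⊥ : Subalgebra k K).toSubring :=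
    Subalgebra.algebraMap_mem _ _
  refine isUnit_iff_exists_inv.mpr ⟨⟨algebraMap k K c⁻¹, hinv⟩, ?_⟩
  apply Subtype.ext
  change (x : K) * algebraMap k K c⁻¹ = 1
  rw [← hc, ← map_mul, mul_inv_cancel₀ hc0, map_one]

end Helpers

/-! ## §1 Position: the crux is implied by relative LU, hence by the summit -/

section Position

/-- Relative local uniformization in characteristic `p` (for all `k, K, O`) implies the crux at
`p`: apply it to the model `R := A₀[t]` (`t ∈ O` because `t ^ p ∈ A₀ ⊆ O`). The regularity of
the base is not used. -/
theorem at_of_relLU {p : ℕ} (hp : p ≠ 0)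
    (H : ∀ (k K : Type) [Field k] [CharP k p] [Field K] [Algebra k K] (O : ValuationSubring K),
      RelLocalUniformization k K O) : At p := by
  intro k K _ _ _ _ O A₀ h₀ t hfg htp hfr _hreg
  have htO : t ∈ O := mem_of_pow_mem O hp (h₀ htp)
  have hRO := adjoin_insert_le O A₀ h₀ htO
  obtain ⟨A, h, hRA, hAfg, hreg⟩ := H k K O _ (fg_adjoin_insert hfg t) hfr hRO
  exact ⟨A, h, (le_adjoin_insert A₀ t).trans hRA, hRA (mem_adjoin_insert A₀ t), hAfg,
    isFractionRing_of_le hRA hfr, hreg⟩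

/-- Resolution of singularities in characteristic `p` implies the crux at `p` (through the
tree's `ResolutionInChar.relLocalUniformization`, the valuative criterion of properness). -/
theorem at_of_resolutionInChar {p : ℕ} (hp : p ≠ 0) (h : ResolutionInChar.{0} p) : At p :=
  at_of_relLU hp fun k K _ _ _ _ O => h.relLocalUniformization k K O

/-- **The summit implies the crux.** Consequently `¬ LuAlphaPTorsor → ¬ ResolutionOfSingularities`:
a counterexample to the crux would be a counterexample to resolution in positive characteristic
(none is known; this is why the crux resists cheap refutation). -/
theorem luAlphaPTorsor_of_resolutionOfSingularities (h : _root_.ResolutionOfSingularities) :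
    LuAlphaPTorsor :=
  fun p hp => at_of_resolutionInChar hp.ne_zero (h p hp)

/-- Contrapositive, for the record. -/
theorem not_resolutionOfSingularities_of_not (h : ¬ LuAlphaPTorsor) :
    ¬ _root_.ResolutionOfSingularities :=
  fun H => h (luAlphaPTorsor_of_resolutionOfSingularities H)

end Position

/-! ## §2 Load-bearing hypotheses -/

section LoadBearing

/-- The crux at `p` WITHOUT the hypothesis `Frac (A₀[t]) = K`. -/
def WithoutFrac (p : ℕ) : Prop :=
  ∀ (k K : Type) [Field k] [CharP k p] [Field K] [Algebra k K] (O : ValuationSubring K)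
    (A₀ : Subalgebra k K) (h₀ : A₀.toSubring ≤ O.toSubring) (t : K), A₀.FG → t ^ p ∈ A₀ →
    IsRegularLocalRing (Localization.AtPrime (Ideal.comap (Subring.inclusion h₀)
      (IsLocalRing.maximalIdeal O))) →
    ∃ (A : Subalgebra k K) (h : A.toSubring ≤ O.toSubring), A₀ ≤ A ∧ t ∈ A ∧ A.FG ∧
      IsFractionRing A K ∧ IsRegularLocalRing (Localization.AtPrime
        (Ideal.comap (Subring.inclusion h) (IsLocalRing.maximalIdeal O)))

/-- **`Frac (A₀[t]) = K` is load-bearing** (bookkeeping): without it `K/k` need not be finitely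
generated and no finitely generated model has fraction field `K`. Witness `k = 𝔽_p`,
`K = 𝔽_p^alg`, `O = K`, `A₀ = k`, `t = 0`: a finitely generated `A ⊆ K` with `Frac A = K` would be
integral, hence finite over `𝔽_p`, hence a finite field equal to `K` — but `K` is infinite. -/
theorem not_withoutFrac (p : ℕ) [hp : Fact p.Prime] : ¬ WithoutFrac p := by
  intro H
  let k := ZMod p
  let K := AlgebraicClosure (ZMod p)
  have h₀ : (⊥ : Subalgebra k K).toSubring ≤ (⊤ : ValuationSubring K).toSubring :=
    fun _ _ => Subring.mem_top _
  have hreg : IsRegularLocalRing (Localization.AtPrime (Ideal.comap (Subring.inclusion h₀)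
      (IsLocalRing.maximalIdeal (⊤ : ValuationSubring K)))) := by
    haveI : IsNoetherianRing (⊥ : Subalgebra k K).toSubring :=
      isNoetherianRing_of_fg Subalgebra.fg_bot
    exact isRegularLocalRing_localization_of_eq_bot _ (centre_top_eq_bot _ h₀)
  obtain ⟨A, h, -, -, hAfg, hAfr, -⟩ := H k K ⊤ ⊥ h₀ 0 Subalgebra.fg_bot
    (by rw [zero_pow hp.out.ne_zero]; exact zero_mem _) hreg
  -- `A` is integral and of finite type over `𝔽_p`, hence finite, hence a finite field
  haveI : Algebra.FiniteType k A := A.fg_iff_finiteType.mp hAfg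
  haveI : Algebra.IsIntegral k A := ⟨fun a =>
    (isIntegral_algHom_iff A.val Subtype.val_injective).mp (Algebra.IsIntegral.isIntegral (a : K))⟩
  haveI : Module.Finite k A := Algebra.IsIntegral.finite
  haveI : Finite A := Module.finite_of_finite k
  have hfield : IsField A := Finite.isField_of_domain A
  have hbij := hfield.localization_map_bijective (M := nonZeroDivisors A) (Rₘ := K)
    zero_notMem_nonZeroDivisors
  haveI : Finite K := Finite.of_surjective _ hbij.2
  exact not_finite K

/-- The crux at `p` WITHOUT the hypothesis `A₀.FG`. -/
def WithoutFG (p : ℕ) : Prop :=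
  ∀ (k K : Type) [Field k] [CharP k p] [Field K] [Algebra k K] (O : ValuationSubring K)
    (A₀ : Subalgebra k K) (h₀ : A₀.toSubring ≤ O.toSubring) (t : K), t ^ p ∈ A₀ →
    IsFractionRing (Algebra.adjoin k (insert t (A₀ : Set K))) K →
    IsRegularLocalRing (Localization.AtPrime (Ideal.comap (Subring.inclusion h₀)
      (IsLocalRing.maximalIdeal O))) →
    ∃ (A : Subalgebra k K) (h : A.toSubring ≤ O.toSubring), A₀ ≤ A ∧ t ∈ A ∧ A.FG ∧
      IsFractionRing A K ∧ IsRegularLocalRing (Localization.AtPrime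
        (Ideal.comap (Subring.inclusion h) (IsLocalRing.maximalIdeal O)))

/-- **`A₀.FG` is load-bearing**: without it take `A₀ = O = K = 𝔽_p(X)` (regular at the centre
`(0)`: a field), `t = 0`; the conclusion forces `K = A` to be a finitely generated `𝔽_p`-ALGEBRA,
which a transcendental field extension never is (Zariski's lemma,
`finite_of_finite_type_of_isJacobsonRing`, and `X` is transcendental). (Morally: the item needs a
finitely generated — hence excellent/Japanese — base; see §4 for the sharper statement that even
a regular, Noetherian but non-excellent base fails.) -/
theorem not_withoutFG (p : ℕ) [hp : Fact p.Prime] : ¬ WithoutFG p := by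
  intro H
  let k := ZMod p
  let K := RatFunc (ZMod p)
  have h₀ : (⊤ : Subalgebra k K).toSubring ≤ (⊤ : ValuationSubring K).toSubring :=
    fun _ _ => Subring.mem_top _
  have hreg : IsRegularLocalRing (Localization.AtPrime (Ideal.comap (Subring.inclusion h₀)
      (IsLocalRing.maximalIdeal (⊤ : ValuationSubring K)))) := by
    haveI : IsNoetherianRing (⊤ : Subalgebra k K).toSubring :=
      isNoetherianRing_of_ringEquiv K (Subalgebra.topEquiv (R := k) (A := K)).toRingEquiv.symm
    exact isRegularLocalRing_localization_of_eq_bot _ (centre_top_eq_bot _ h₀)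
  have hfr : IsFractionRing (Algebra.adjoin k (insert (0 : K) ((⊤ : Subalgebra k K) : Set K))) K :=
    isFractionRing_of_le (le_adjoin_insert ⊤ 0) <|
      IsFractionRing.of_field (⊤ : Subalgebra k K) K fun z =>
        ⟨⟨z, Algebra.mem_top⟩, 1, by simp⟩
  obtain ⟨A, h, htopA, -, hAfg, -, -⟩ := H k K ⊤ ⊤ h₀ 0 (Algebra.mem_top) hfr hreg
  have hA : A = ⊤ := top_le_iff.mp htopA
  subst hA
  haveI : Algebra.FiniteType k K := ⟨hAfg⟩
  haveI : Module.Finite k K := finite_of_finite_type_of_isJacobsonRing k K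
  have halg : Algebra.IsAlgebraic k K := Algebra.IsAlgebraic.of_finite k K
  have hX : Transcendental k (RatFunc.X : K) := by
    rw [← RatFunc.algebraMap_X, transcendental_algebraMap_iff (RatFunc.algebraMap_injective k)]
    exact Polynomial.transcendental_X k
  exact hX (halg.isAlgebraic _)

/-- The crux at `p` WITHOUT the hypothesis `t ^ p ∈ A₀` (so `t : K` is arbitrary). -/
def WithoutTorsor (p : ℕ) : Prop :=
  ∀ (k K : Type) [Field k] [CharP k p] [Field K] [Algebra k K] (O : ValuationSubring K)
    (A₀ : Subalgebra k K) (h₀ : A₀.toSubring ≤ O.toSubring) (t : K), A₀.FG →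
    IsFractionRing (Algebra.adjoin k (insert t (A₀ : Set K))) K →
    IsRegularLocalRing (Localization.AtPrime (Ideal.comap (Subring.inclusion h₀)
      (IsLocalRing.maximalIdeal O))) →
    ∃ (A : Subalgebra k K) (h : A.toSubring ≤ O.toSubring), A₀ ≤ A ∧ t ∈ A ∧ A.FG ∧
      IsFractionRing A K ∧ IsRegularLocalRing (Localization.AtPrime
        (Ideal.comap (Subring.inclusion h) (IsLocalRing.maximalIdeal O)))

/-- **`t ^ p ∈ A₀` is load-bearing, but only for a junk reason**: it is the only hypothesis
forcing `t ∈ O`, and the conclusion demands `t ∈ A ⊆ O`. Witness `k = 𝔽_p`, `K = 𝔽_p(X)`,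
`A₀ = k`, `t = X`, `O = O_∞` (the valuation ring at infinity, `X ∉ O_∞`). The honest mutation —
arbitrary `t ∈ O` over a base regular at the centre — is `WithoutTorsorMemO` below; it follows
from relative LU (`withoutTorsorMemO_of_relLU`) and implies the crux, so it is open, not
refutable. -/
theorem not_withoutTorsor (p : ℕ) [hp : Fact p.Prime] : ¬ WithoutTorsor p := by
  classical
  intro H
  let k := ZMod p
  let K := RatFunc (ZMod p)
  let O : ValuationSubring K := (RatFunc.inftyValuation k).valuationSubring
  have hXO : (RatFunc.X : K) ∉ O := by
    change ¬ (RatFunc.inftyValuation k (RatFunc.X : K) ≤ 1)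
    rw [not_le, RatFunc.inftyValuation.X, ← WithZero.exp_zero, WithZero.exp_lt_exp]
    exact zero_lt_one
  have h₀ : (⊥ : Subalgebra k K).toSubring ≤ O.toSubring := by
    intro x hx
    have hx' : x ∈ (⊥ : Subalgebra k K) := hx
    rw [Algebra.mem_bot] at hx'
    obtain ⟨c, rfl⟩ := hx'
    change RatFunc.inftyValuation k (algebraMap k K c) ≤ 1
    by_cases hc : c = 0
    · simp [hc]
    · have : (algebraMap k K c) = RatFunc.C c := rfl
      rw [this, RatFunc.inftyValuation.C k hc]
  have hreg : IsRegularLocalRing (Localization.AtPrime (Ideal.comap (Subring.inclusion h₀)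
      (IsLocalRing.maximalIdeal O))) := by
    haveI : IsNoetherianRing (⊥ : Subalgebra k K).toSubring :=
      isNoetherianRing_of_fg Subalgebra.fg_bot
    exact isRegularLocalRing_localization_of_eq_bot _
      (ideal_bot_eq_bot _ Ideal.IsPrime.ne_top')
  have hfr : IsFractionRing (Algebra.adjoin k (insert (RatFunc.X : K)
      ((⊥ : Subalgebra k K) : Set K))) K := by
    refine IsFractionRing.of_field _ K fun z => ?_
    have hmem : ∀ q : Polynomial k, algebraMap (Polynomial k) K q ∈
        Algebra.adjoin k (insert (RatFunc.X : K) ((⊥ : Subalgebra k K) : Set K)) := by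
      intro q
      have : algebraMap (Polynomial k) K q = Polynomial.aeval (RatFunc.X : K) q := by
        rw [← RatFunc.algebraMap_X, Polynomial.aeval_algebraMap_apply,
          Polynomial.aeval_X_left_apply]
      rw [this]
      exact Algebra.adjoin_mono (Set.singleton_subset_iff.mpr (Set.mem_insert _ _))
        (Polynomial.aeval_mem_adjoin_singleton k _)
    refine ⟨⟨_, hmem z.num⟩, ⟨_, hmem z.denom⟩, ?_⟩
    exact (RatFunc.num_div_denom z).symm
  obtain ⟨A, h, -, htA, -, -, -⟩ := H k K O ⊥ h₀ RatFunc.X Subalgebra.fg_bot hfr hreg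
  exact hXO (h htA)

/-- The honest mutation of `WithoutTorsor`: arbitrary `t ∈ O` over a base regular at the centre
(local uniformization of a simple extension of a regular model). -/
def WithoutTorsorMemO (p : ℕ) : Prop :=
  ∀ (k K : Type) [Field k] [CharP k p] [Field K] [Algebra k K] (O : ValuationSubring K)
    (A₀ : Subalgebra k K) (h₀ : A₀.toSubring ≤ O.toSubring) (t : K), A₀.FG → t ∈ O →
    IsFractionRing (Algebra.adjoin k (insert t (A₀ : Set K))) K →
    IsRegularLocalRing (Localization.AtPrime (Ideal.comap (Subring.inclusion h₀)
      (IsLocalRing.maximalIdeal O))) →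
    ∃ (A : Subalgebra k K) (h : A.toSubring ≤ O.toSubring), A₀ ≤ A ∧ t ∈ A ∧ A.FG ∧
      IsFractionRing A K ∧ IsRegularLocalRing (Localization.AtPrime
        (Ideal.comap (Subring.inclusion h) (IsLocalRing.maximalIdeal O)))

/-- Relative LU implies the honest torsor-free mutation. -/
theorem withoutTorsorMemO_of_relLU {p : ℕ}
    (H : ∀ (k K : Type) [Field k] [CharP k p] [Field K] [Algebra k K] (O : ValuationSubring K),
      RelLocalUniformization k K O) : WithoutTorsorMemO p := by
  intro k K _ _ _ _ O A₀ h₀ t hfg htO hfr _hreg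
  have hRO := adjoin_insert_le O A₀ h₀ htO
  obtain ⟨A, h, hRA, hAfg, hreg⟩ := H k K O _ (fg_adjoin_insert hfg t) hfr hRO
  exact ⟨A, h, (le_adjoin_insert A₀ t).trans hRA, hRA (mem_adjoin_insert A₀ t), hAfg,
    isFractionRing_of_le hRA hfr, hreg⟩

/-- The honest torsor-free mutation implies the crux. -/
theorem at_of_withoutTorsorMemO {p : ℕ} (hp : p ≠ 0) (H : WithoutTorsorMemO p) : At p :=
  fun k K _ _ _ _ O A₀ h₀ t hfg htp hfr hreg =>
    H k K O A₀ h₀ t hfg (mem_of_pow_mem O hp (h₀ htp)) hfr hreg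

/-- The crux at `p` WITHOUT regularity of the base `A₀` at the centre. -/
def WithoutRegular (p : ℕ) : Prop :=
  ∀ (k K : Type) [Field k] [CharP k p] [Field K] [Algebra k K] (O : ValuationSubring K)
    (A₀ : Subalgebra k K) (h₀ : A₀.toSubring ≤ O.toSubring) (t : K), A₀.FG → t ^ p ∈ A₀ →
    IsFractionRing (Algebra.adjoin k (insert t (A₀ : Set K))) K →
    ∃ (A : Subalgebra k K) (h : A.toSubring ≤ O.toSubring), A₀ ≤ A ∧ t ∈ A ∧ A.FG ∧
      IsFractionRing A K ∧ IsRegularLocalRing (Localization.AtPrime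
        (Ideal.comap (Subring.inclusion h) (IsLocalRing.maximalIdeal O)))

/-- **Dropping regularity of the base gives back EXACTLY relative local uniformization in
characteristic `p`** (Novacoski–Spivakovsky's Def. 2.20 form `RelLocalUniformization`, for all
`k` of characteristic `p`, all `K`, all `O`). So the regularity hypothesis is the whole point of
Temkin's reduction (it isolates the difficulty in ONE purely inseparable hypersurface over a
regular germ); it cannot be shown necessary by a counterexample, since the weakened statement is
implied by the summit (`ResolutionInChar.relLocalUniformization`). -/
theorem withoutRegular_iff_relLU (p : ℕ) (hp : p ≠ 0) :
    WithoutRegular p ↔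
      ∀ (k K : Type) [Field k] [CharP k p] [Field K] [Algebra k K] (O : ValuationSubring K),
        RelLocalUniformization k K O := by
  constructor
  · intro H k K _ _ _ _ O R hRfg hRfr hRO
    have hfr : IsFractionRing (Algebra.adjoin k (insert (0 : K) (R : Set K))) K :=
      isFractionRing_of_le (le_adjoin_insert R 0) hRfr
    obtain ⟨A, h, hRA, -, hAfg, -, hreg⟩ := H k K O R hRO 0 hRfg
      (by rw [zero_pow hp]; exact zero_mem _) hfr
    exact ⟨A, h, hRA, hAfg, hreg⟩
  · intro H k K _ _ _ _ O A₀ h₀ t hfg htp hfr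
    have htO : t ∈ O := mem_of_pow_mem O hp (h₀ htp)
    have hRO := adjoin_insert_le O A₀ h₀ htO
    obtain ⟨A, h, hRA, hAfg, hreg⟩ := H k K O _ (fg_adjoin_insert hfg t) hfr hRO
    exact ⟨A, h, (le_adjoin_insert A₀ t).trans hRA, hRA (mem_adjoin_insert A₀ t), hAfg,
      isFractionRing_of_le hRA hfr, hreg⟩

/-- `WithoutRegular p → At p` (trivially: one hypothesis fewer). -/
theorem at_of_withoutRegular {p : ℕ} (H : WithoutRegular p) : At p :=
  fun k K _ _ _ _ O A₀ h₀ t hfg htp hfr _ => H k K O A₀ h₀ t hfg htp hfr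

/-- `LUrel_p`, the first conjunct of the route target `ValuativeThesisRel` at the prime `p`
(body copied verbatim). -/
def Lurel (p : ℕ) : Prop :=
  ∀ (k K : Type) [Field k] [CharP k p] [Field K] [Algebra k K], (⊤ : IntermediateField k K).FG →
    ∀ O : ValuationSubring K, (∀ c : k, algebraMap k K c ∈ O) → ∀ R : Subalgebra k K, R.FG →
    R.toSubring ≤ O.toSubring → ∃ (A : Subalgebra k K) (h : A.toSubring ≤ O.toSubring),
      R ≤ A ∧ A.FG ∧ IsFractionRing A K ∧ IsRegularLocalRing (Localization.AtPrime
        (Ideal.comap (Subring.inclusion h) (IsLocalRing.maximalIdeal O)))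

/-- The route target is `∀ p prime, LUrel_p ∧ (LUrel_p → ResolutionInChar p)` (definitional). -/
theorem valuativeThesisRel_iff :
    Summit.ResolutionOfSingularities.ResolutionOfSingularities.Theses.Valuative.ValuativeThesisRel ↔
      ∀ p : ℕ, p.Prime → Lurel p ∧ (Lurel p → ResolutionInChar.{0} p) :=
  Iff.rfl

/-- `LUrel_p` (the route's form: `K/k` finitely generated, `R` any finitely generated subalgebra
of `O`) is equivalent to `RelLocalUniformization` for all `k, K, O` (the form with `Frac R = K`):
enlarge `R` by an affine model of `O` (`exists_affineModel`) in one direction, read `K/k`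
finitely generated off `Frac R = K` in the other. -/
theorem lurel_iff_relLU (p : ℕ) :
    Lurel p ↔
      ∀ (k K : Type) [Field k] [CharP k p] [Field K] [Algebra k K] (O : ValuationSubring K),
        RelLocalUniformization k K O := by
  constructor
  · intro H k K _ _ _ _ O R hRfg hRfr hRO
    have hKfg : (⊤ : IntermediateField k K).FG := by
      obtain ⟨s, rfl⟩ := hRfg
      refine ⟨s, top_le_iff.mp fun z _ => ?_⟩
      obtain ⟨a, b, -, rfl⟩ := IsFractionRing.div_surjective (A := Algebra.adjoin k (s : Set K)) z
      exact div_mem (IntermediateField.algebra_adjoin_le_adjoin k _ a.2)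
        (IntermediateField.algebra_adjoin_le_adjoin k _ b.2)
    have hkO : ∀ c : k, algebraMap k K c ∈ O := fun c => hRO (R.algebraMap_mem c)
    obtain ⟨A, h, hRA, hAfg, -, hreg⟩ := H k K hKfg O hkO R hRfg hRO
    exact ⟨A, h, hRA, hAfg, hreg⟩
  · intro H k K _ _ _ _ hKfg O hkO R hRfg hRO
    obtain ⟨A₀, hA₀O, hA₀fg, hA₀fr⟩ := exists_affineModel k K hKfg O hkO
    have hR'O : (R ⊔ A₀).toSubring ≤ O.toSubring := by
      let Oalg : Subalgebra k K := { O.toSubring with algebraMap_mem' := hkO }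
      change R ⊔ A₀ ≤ Oalg
      exact sup_le (fun x hx => hRO hx) (fun x hx => hA₀O hx)
    have hR'fr : IsFractionRing ↥(R ⊔ A₀) K := isFractionRing_of_le le_sup_right hA₀fr
    obtain ⟨A, hA, hle, hAfg, hreg⟩ := H k K O (R ⊔ A₀) (hRfg.sup hA₀fg) hR'fr hR'O
    exact ⟨A, hA, le_sup_left.trans hle, hAfg, isFractionRing_of_le hle hR'fr, hreg⟩

/-- **Dropping regularity of the base = the route's own `LUrel_p`.** -/
theorem withoutRegular_iff_lurel (p : ℕ) (hp : p ≠ 0) : WithoutRegular p ↔ Lurel p := by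
  rw [withoutRegular_iff_relLU p hp, lurel_iff_relLU]

/-- `LUrel_p → At p`: the crux is a special case of the route target's first conjunct. -/
theorem at_of_lurel {p : ℕ} (hp : p ≠ 0) (H : Lurel p) : At p :=
  at_of_withoutRegular ((withoutRegular_iff_lurel p hp).mpr H)

end LoadBearing

/-! ## §3 Degenerate instances are TRUE (no junk falsity) -/

section Degenerate

variable {p : ℕ} {k K : Type} [Field k] [CharP k p] [Field K] [Algebra k K]

/-- **Case `t ∈ A₀`** (in particular `t = 0`, or `[K : Frac A₀] = 1` with `t` already in the
model): `A := A₀` works. -/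
theorem case_mem (O : ValuationSubring K) (A₀ : Subalgebra k K)
    (h₀ : A₀.toSubring ≤ O.toSubring) (t : K) (hfg : A₀.FG) (ht : t ∈ A₀)
    (hfr : IsFractionRing (Algebra.adjoin k (insert t (A₀ : Set K))) K)
    (hreg : IsRegularLocalRing (Localization.AtPrime (Ideal.comap (Subring.inclusion h₀)
      (IsLocalRing.maximalIdeal O)))) :
    ∃ (A : Subalgebra k K) (h : A.toSubring ≤ O.toSubring), A₀ ≤ A ∧ t ∈ A ∧ A.FG ∧
      IsFractionRing A K ∧ IsRegularLocalRing (Localization.AtPrime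
        (Ideal.comap (Subring.inclusion h) (IsLocalRing.maximalIdeal O))) := by
  have hle : Algebra.adjoin k (insert t (A₀ : Set K)) ≤ A₀ := by
    refine Algebra.adjoin_le ?_
    rintro x (rfl | hx)
    · exact ht
    · exact hx
  exact ⟨A₀, h₀, le_rfl, ht, hfg, isFractionRing_of_le hle hfr, hreg⟩

/-- **Case `O = K`** (the trivial valuation, centre `(0)`): `A := A₀[t]` works, its localisation
at the centre being the field `K`. -/
theorem case_top (A₀ : Subalgebra k K) (t : K) (hfg : A₀.FG)
    (hfr : IsFractionRing (Algebra.adjoin k (insert t (A₀ : Set K))) K) :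
    ∃ (A : Subalgebra k K) (h : A.toSubring ≤ (⊤ : ValuationSubring K).toSubring),
      A₀ ≤ A ∧ t ∈ A ∧ A.FG ∧ IsFractionRing A K ∧ IsRegularLocalRing (Localization.AtPrime
        (Ideal.comap (Subring.inclusion h) (IsLocalRing.maximalIdeal (⊤ : ValuationSubring K)))) := by
  have h : (Algebra.adjoin k (insert t (A₀ : Set K))).toSubring ≤
      (⊤ : ValuationSubring K).toSubring := fun _ _ => Subring.mem_top _
  haveI : IsNoetherianRing (Algebra.adjoin k (insert t (A₀ : Set K))).toSubring :=
    isNoetherianRing_of_fg (fg_adjoin_insert hfg t)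
  exact ⟨_, h, le_adjoin_insert A₀ t, mem_adjoin_insert A₀ t, fg_adjoin_insert hfg t, hfr,
    isRegularLocalRing_localization_of_eq_bot _ (centre_top_eq_bot _ h)⟩

end Degenerate

/-! ## §3b The birational case `t ∈ Frac A₀` is TRUE (regular ⇒ normal) -/

section Birational

open Literature.AlgebraicGeometry.Resolution

variable {k K : Type} [Field k] [Field K] [Algebra k K]

/-- **Case `[K : Frac A₀] = 1`** (i.e. `Frac A₀ = K`, equivalently `t ∈ Frac A₀`): `A := A₀[t]`
works. The local ring `(A₀)_𝔭` at the centre is regular, hence NORMAL (Matsumura Thm. 19.4,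
PROVED in the tree: `isIntegrallyClosed_of_isRegularLocalRing`); `t` is integral over it
(`t ^ p ∈ A₀`), so `t ∈ (A₀)_𝔭 ⊆ K`, whence `A₀ ⊆ A₀[t] ⊆ (A₀)_𝔭` and the two models have the
same local ring at the centre (Novacoski–Spivakovsky Lemma 2.5 (1), `centreLocalization_le`).
This settles the planner's "degenerate case" and shows the live content of the crux is exactly
the purely inseparable degree-`p` case `t ∉ Frac A₀`. (The grounders' warning "regular ⇒ normal
is not in Mathlib" is moot: it is in the tree.) -/
theorem case_frac (O : ValuationSubring K) (A₀ : Subalgebra k K)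
    (h₀ : A₀.toSubring ≤ O.toSubring) (t : K) (hfg : A₀.FG) {n : ℕ} (hn : n ≠ 0)
    (htn : t ^ n ∈ A₀) (hfr₀ : IsFractionRing A₀ K)
    (hreg : IsRegularLocalRing (Localization.AtPrime (Ideal.comap (Subring.inclusion h₀)
      (IsLocalRing.maximalIdeal O)))) :
    ∃ (A : Subalgebra k K) (h : A.toSubring ≤ O.toSubring), A₀ ≤ A ∧ t ∈ A ∧ A.FG ∧
      IsFractionRing A K ∧ IsRegularLocalRing (Localization.AtPrime
        (Ideal.comap (Subring.inclusion h) (IsLocalRing.maximalIdeal O))) := by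
  classical
  set A : Subalgebra k K := Algebra.adjoin k (insert t (A₀ : Set K)) with hA
  have htO : t ∈ O := mem_of_pow_mem O hn (h₀ htn)
  have hAO : A.toSubring ≤ O.toSubring := adjoin_insert_le O A₀ h₀ htO
  have hA₀A : A₀ ≤ A := le_adjoin_insert A₀ t
  haveI : IsFractionRing A₀.toSubring K := hfr₀
  haveI : IsFractionRing A.toSubring K := isFractionRing_subalgebra_of_le A₀ A hA₀A
  refine ⟨A, hAO, hA₀A, mem_adjoin_insert A₀ t, fg_adjoin_insert hfg t,
    isFractionRing_of_le hA₀A hfr₀, ?_⟩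
  -- the local ring `Λ₀ = (A₀)_𝔭 ⊆ K` is regular, hence integrally closed in `K`
  set Λ₀ : Subalgebra A₀.toSubring K := Localization.subalgebra.ofField K
    ((maximalIdeal O).comap (Subring.inclusion h₀)).primeCompl
    (Ideal.primeCompl_le_nonZeroDivisors _) with hΛ₀
  have hreg₀ : IsRegularLocalRing Λ₀ := (isRegularLocalRing_iff_centreLocalization O A₀ h₀).mp hreg
  haveI : IsIntegrallyClosed Λ₀ := isIntegrallyClosed_of_isRegularLocalRing Λ₀
  -- `t ∈ Λ₀`
  have htΛ : t ∈ Λ₀ := by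
    have htnΛ : t ^ n ∈ Λ₀ := le_centreLocalization O A₀ h₀ htn
    have hint : IsIntegral Λ₀ t :=
      ⟨Polynomial.X ^ n - Polynomial.C ⟨t ^ n, htnΛ⟩, Polynomial.monic_X_pow_sub_C _ hn, by
        simp [Polynomial.eval₂_sub, Polynomial.eval₂_X_pow, Polynomial.eval₂_C]⟩
    obtain ⟨y, hy⟩ := IsIntegrallyClosed.algebraMap_eq_of_integral hint
    rw [← hy]
    exact y.2
  -- hence `A ⊆ Λ₀` and the local rings of `A` and `A₀` at the centre coincide
  have hAΛ : (A : Set K) ⊆ Λ₀ := by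
    let Λk : Subalgebra k K :=
      { Λ₀.toSubring with
        algebraMap_mem' := fun c => le_centreLocalization O A₀ h₀ (A₀.algebraMap_mem c) }
    change A ≤ Λk
    rw [hA]
    refine Algebra.adjoin_le ?_
    rintro x (rfl | hx)
    · exact htΛ
    · exact le_centreLocalization O A₀ h₀ hx
  have heq : ((Localization.subalgebra.ofField K
      ((maximalIdeal O).comap (Subring.inclusion hAO)).primeCompl
      (Ideal.primeCompl_le_nonZeroDivisors _)) : Set K) = Λ₀ :=
    le_antisymm (centreLocalization_le O A A₀ hAO h₀ hAΛ)
      (centreLocalization_le O A₀ A h₀ hAO fun x hx => le_centreLocalization O A hAO (hA₀A hx))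
  exact isRegularLocalRing_of_centreLocalization_eq O A A₀ hAO h₀ heq hreg

end Birational

/-! ## §3c Known ranges: `trdeg ≤ 1` unconditionally, `trdeg ≤ 3` from Cossart–Piltant -/

section KnownRanges

open Literature.AlgebraicGeometry.Resolution

variable {k K : Type} [Field k] [Field K] [Algebra k K]

/-- Pointwise form of §1: relative LU of THIS `O` already gives the conclusion of the crux for
every torsor datum over `O` (regularity of the base unused). -/
theorem concl_of_relLU (O : ValuationSubring K) (H : RelLocalUniformization k K O)
    (A₀ : Subalgebra k K) (h₀ : A₀.toSubring ≤ O.toSubring) (t : K) (hfg : A₀.FG) (htO : t ∈ O)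
    (hfr : IsFractionRing (Algebra.adjoin k (insert t (A₀ : Set K))) K) :
    ∃ (A : Subalgebra k K) (h : A.toSubring ≤ O.toSubring), A₀ ≤ A ∧ t ∈ A ∧ A.FG ∧
      IsFractionRing A K ∧ IsRegularLocalRing (Localization.AtPrime
        (Ideal.comap (Subring.inclusion h) (IsLocalRing.maximalIdeal O))) := by
  have hRO := adjoin_insert_le O A₀ h₀ htO
  obtain ⟨A, h, hRA, hAfg, hreg⟩ := H _ (fg_adjoin_insert hfg t) hfr hRO
  exact ⟨A, h, (le_adjoin_insert A₀ t).trans hRA, hRA (mem_adjoin_insert A₀ t), hAfg,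
    isFractionRing_of_le hRA hfr, hreg⟩

/-- **Transcendence degree `≤ 3` (dim `A₀[t] ≤ 3`): the crux holds, conditionally on the vendored
fact `CossartPiltant2019`** (resolution of quasi-excellent schemes of dimension `≤ 3`; through the
tree's `CossartPiltant2019.lu3` and `CossartPiltant2019LU3.relLocalUniformization`). So a
counterexample needs `trdeg_k K ≥ 4`, for EVERY `p` and every `k`. -/
theorem concl_of_trdeg_le_three (hCP : CossartPiltant2019.{0}) (hK : Algebra.trdeg k K ≤ 3)
    (O : ValuationSubring K) (A₀ : Subalgebra k K) (h₀ : A₀.toSubring ≤ O.toSubring) (t : K)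
    (hfg : A₀.FG) {n : ℕ} (hn : n ≠ 0) (htn : t ^ n ∈ A₀)
    (hfr : IsFractionRing (Algebra.adjoin k (insert t (A₀ : Set K))) K) :
    ∃ (A : Subalgebra k K) (h : A.toSubring ≤ O.toSubring), A₀ ≤ A ∧ t ∈ A ∧ A.FG ∧
      IsFractionRing A K ∧ IsRegularLocalRing (Localization.AtPrime
        (Ideal.comap (Subring.inclusion h) (IsLocalRing.maximalIdeal O))) :=
  concl_of_relLU O (hCP.lu3.relLocalUniformization k K hK O) A₀ h₀ t hfg
    (mem_of_pow_mem O hn (h₀ htn)) hfr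

/-- **Transcendence degree `≤ 1` (curves): the crux holds UNCONDITIONALLY, for every `p` and every
ground field `k`** (perfect or not, `[k : k^p]` finite or not). Local uniformization of excellent
one-dimensional domains is finite normalization (tree:
`exists_closure_isRegularLocalRing_of_ringKrullDim_le_one`, Kollár Thm. 1.101 / Stacks 0BXV),
and finitely generated algebras over a field are excellent (`Stacks07QW_field_holds`). The base
`A₀` need not even be regular here. So a counterexample needs `trdeg_k K ≥ 2` unconditionally
(and `≥ 4` modulo Cossart–Piltant). -/
theorem concl_of_trdeg_le_one (hK : Algebra.trdeg k K ≤ 1)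
    (O : ValuationSubring K) (A₀ : Subalgebra k K) (h₀ : A₀.toSubring ≤ O.toSubring) (t : K)
    (hfg : A₀.FG) (htO : t ∈ O)
    (hfr : IsFractionRing (Algebra.adjoin k (insert t (A₀ : Set K))) K) :
    ∃ (A : Subalgebra k K) (h : A.toSubring ≤ O.toSubring), A₀ ≤ A ∧ t ∈ A ∧ A.FG ∧
      IsFractionRing A K ∧ IsRegularLocalRing (Localization.AtPrime
        (Ideal.comap (Subring.inclusion h) (IsLocalRing.maximalIdeal O))) := by
  classical
  set R : Subalgebra k K := Algebra.adjoin k (insert t (A₀ : Set K)) with hR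
  have hRO : R.toSubring ≤ O.toSubring := adjoin_insert_le O A₀ h₀ htO
  have hRfg : R.FG := fg_adjoin_insert hfg t
  haveI : IsFractionRing R K := hfr
  haveI : IsNoetherianRing R.toSubring := isNoetherianRing_of_fg hRfg
  -- either the centre is `(0)` (then `R` itself works) or it contains some `b ≠ 0`
  by_cases hbot : Ideal.comap (Subring.inclusion hRO) (maximalIdeal O) = ⊥
  · exact ⟨R, hRO, le_adjoin_insert A₀ t, mem_adjoin_insert A₀ t, hRfg, hfr,
      isRegularLocalRing_localization_of_eq_bot _ hbot⟩
  obtain ⟨b, hb, hb0⟩ : ∃ b ∈ Ideal.comap (Subring.inclusion hRO) (maximalIdeal O), b ≠ 0 := by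
    by_contra! hcon
    exact hbot ((Submodule.eq_bot_iff _).mpr hcon)
  have hb0' : (b : K) ≠ 0 := fun h => hb0 (Subtype.ext h)
  have hvb : O.valuation (b : K) < 1 := (mem_subringCentre_iff hRO b).mp hb
  -- `R` is excellent of dimension `≤ 1` with fraction field `K`
  haveI : Algebra.FiniteType k R := R.fg_iff_finiteType.mp hRfg
  have hexc : IsExcellentRing R.toSubring := Stacks07QW_field_holds k R inferInstance
  have hdim : ringKrullDim R.toSubring ≤ 1 :=
    ringKrullDim_le_of_fg_of_trdeg_le R hRfg (by exact_mod_cast hK)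
  have hfrac : ∀ z : K, ∃ a s : R.toSubring, (s : K) ≠ 0 ∧ z * s = a := by
    intro z
    obtain ⟨a, s, hs, rfl⟩ := IsFractionRing.div_surjective (A := R) z
    have hs0 : (s : K) ≠ 0 := fun h => nonZeroDivisors.ne_zero hs (Subtype.ext h)
    exact ⟨a, s, hs0, div_mul_cancel₀ _ hs0⟩
  obtain ⟨t', ht', hreg⟩ :=
    exists_closure_isRegularLocalRing_of_ringKrullDim_le_one O R.toSubring hexc hdim hRO hfrac
      hb0' hvb
  -- the model `A = R[t'] = R ⊔ k[t']`
  set A : Subalgebra k K := R ⊔ Algebra.adjoin k (t' : Set K) with hA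
  have h1 : A = Algebra.adjoin k ((R : Set K) ∪ ↑t') := by
    rw [hA, Algebra.adjoin_union, Algebra.adjoin_eq]
  have heq : A.toSubring = Subring.closure ((R.toSubring : Set K) ∪ ↑t') := by
    rw [h1, Algebra.adjoin_eq_ring_closure]
    apply le_antisymm
    · refine Subring.closure_le.mpr ?_
      rintro x (⟨c, rfl⟩ | hx)
      · exact Subring.subset_closure (Or.inl (R.algebraMap_mem c))
      · exact Subring.subset_closure hx
    · exact Subring.closure_mono Set.subset_union_right
  have hAO : A.toSubring ≤ O.toSubring := heq ▸ ht'
  have hRA : R ≤ A := le_sup_left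
  refine ⟨A, hAO, (le_adjoin_insert A₀ t).trans hRA, hRA (mem_adjoin_insert A₀ t),
    hRfg.sup (Subalgebra.fg_adjoin_finset _), isFractionRing_of_le hRA hfr, ?_⟩
  exact (isRegularLocalRing_centre_congr heq hAO ht').mpr hreg

/-- `At p` restricted to `trdeg ≤ 1` holds outright (corollary, in the crux's own binder shape). -/
theorem at_trdeg_le_one {p : ℕ} (hp : p ≠ 0) (k K : Type) [Field k] [CharP k p] [Field K]
    [Algebra k K] (hK : Algebra.trdeg k K ≤ 1) (O : ValuationSubring K) (A₀ : Subalgebra k K)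
    (h₀ : A₀.toSubring ≤ O.toSubring) (t : K) (hfg : A₀.FG) (htp : t ^ p ∈ A₀)
    (hfr : IsFractionRing (Algebra.adjoin k (insert t (A₀ : Set K))) K) :
    ∃ (A : Subalgebra k K) (h : A.toSubring ≤ O.toSubring), A₀ ≤ A ∧ t ∈ A ∧ A.FG ∧
      IsFractionRing A K ∧ IsRegularLocalRing (Localization.AtPrime
        (Ideal.comap (Subring.inclusion h) (IsLocalRing.maximalIdeal O))) :=
  concl_of_trdeg_le_one hK O A₀ h₀ t hfg (mem_of_pow_mem O hp (h₀ htp)) hfr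

end KnownRanges

/-! ## §3d Abhyankar valuations: TRUE unconditionally (Knaf–Kuhlmann 2005, proved in the tree) -/

section Abhyankar

open Literature.AlgebraicGeometry.Resolution

variable {k K : Type} [Field k] [Field K] [Algebra k K]

/-- The ground field `k` as a subfield of `K` (the vocabulary of the Knaf–Kuhlmann files). -/
abbrev groundSubfield (k K : Type) [Field k] [Field K] [Algebra k K] : Subfield K :=
  (algebraMap k K).fieldRange

theorem mem_groundSubfield_iff {x : K} :
    x ∈ groundSubfield k K ↔ ∃ c : k, algebraMap k K c = x := RingHom.mem_fieldRange

/-- A subalgebra over the subfield `k' = im (k → K)` is a `k`-subalgebra with the same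
underlying subring. -/
def restrictGround (A' : Subalgebra (groundSubfield k K) K) : Subalgebra k K :=
  { A'.toSubring with
    algebraMap_mem' := fun c => A'.algebraMap_mem ⟨algebraMap k K c, ⟨c, rfl⟩⟩ }

theorem restrictGround_toSubring (A' : Subalgebra (groundSubfield k K) K) :
    (restrictGround A').toSubring = A'.toSubring := rfl

theorem mem_restrictGround_iff (A' : Subalgebra (groundSubfield k K) K) (x : K) :
    x ∈ restrictGround A' ↔ x ∈ A' := Iff.rfl

/-- `Algebra.adjoin` over `k` and over its image subfield have the same underlying subring. -/
theorem adjoin_groundSubfield_toSubring (s : Set K) :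
    (Algebra.adjoin (groundSubfield k K) s).toSubring = (Algebra.adjoin k s).toSubring := by
  rw [Algebra.adjoin_eq_ring_closure, Algebra.adjoin_eq_ring_closure]
  congr 1
  ext x
  simp only [Set.mem_union, Set.mem_range]
  constructor
  · rintro (⟨⟨y, ⟨c, rfl⟩⟩, rfl⟩ | hx)
    · exact Or.inl ⟨c, rfl⟩
    · exact Or.inr hx
  · rintro (⟨c, rfl⟩ | hx)
    · exact Or.inl ⟨⟨algebraMap k K c, ⟨c, rfl⟩⟩, rfl⟩
    · exact Or.inr hx

/-- **The crux holds along every ABHYANKAR valuation (with separable residue field extension),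
in every dimension and every characteristic — UNCONDITIONALLY** (the tree PROVES Knaf–Kuhlmann
2005, Thm. 1.1, `KnafKuhlmann2005_Thm11_holds`, from Kuhlmann's generalized stability theorem,
and EGA IV 17.5.8 "smooth ⇒ regular", `isRegularLocalRing_of_isSmoothAt`). Here "Abhyankar" is
equality in Abhyankar's inequality `trdeg K/k = rat.rk (vK) + trdeg (Kv/k)`
(`IsAbhyankarPlace`, e.g. every divisorial valuation, every monomial valuation of maximal
rational rank, every zero-dimensional valuation of rank `= trdeg`), and the residue field
extension `Kv/k` is asked to be separably generated (`SeparablyGeneratedOver`, automatic over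
perfect `k`). The regularity of the base `A₀` and the torsor shape are NOT used: KK05 uniformizes
`(O, Z)` for the finite set `Z` of generators of `A₀[t]` on a model SMOOTH at the centre with
`Z` in the local ring; adjoining `Z` to that model does not change the local ring
(Novacoski–Spivakovsky Lemma 2.5 (1)). CONSEQUENCE FOR THE SEARCH: a counterexample to the crux
must use a NON-Abhyankar valuation (`rk + rat.rk-defect + residual trdeg < trdeg K`: the
valuations with "room for defect" — infinitely singular arcs, non-discrete rank-one groups …),
on top of `trdeg ≥ 4` (§3c) and `t ∉ Frac A₀` (§3b). -/
theorem concl_of_isAbhyankarPlace (O : ValuationSubring K) (A₀ : Subalgebra k K)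
    (h₀ : A₀.toSubring ≤ O.toSubring) (t : K) (hfg : A₀.FG) (htO : t ∈ O)
    (hfr : IsFractionRing (Algebra.adjoin k (insert t (A₀ : Set K))) K)
    (hAbh : IsAbhyankarPlace O (groundSubfield k K) ⊤)
    (hsep : SeparablyGeneratedOver (resField O (groundSubfield k K)) (resField O ⊤)) :
    ∃ (A : Subalgebra k K) (h : A.toSubring ≤ O.toSubring), A₀ ≤ A ∧ t ∈ A ∧ A.FG ∧
      IsFractionRing A K ∧ IsRegularLocalRing (Localization.AtPrime
        (Ideal.comap (Subring.inclusion h) (IsLocalRing.maximalIdeal O))) := by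
  classical
  set Kf : Subfield K := groundSubfield k K with hKf
  set R : Subalgebra k K := Algebra.adjoin k (insert t (A₀ : Set K)) with hR
  have hRO : R.toSubring ≤ O.toSubring := adjoin_insert_le O A₀ h₀ htO
  haveI hfrR : IsFractionRing R K := hfr
  obtain ⟨s, hs⟩ := hfg
  -- the finite set of generators of `A₀[t]`
  set Z : Finset K := insert t s with hZ
  have hRZ : R = Algebra.adjoin k (Z : Set K) := by
    rw [hR, ← hs, Algebra.adjoin_insert_adjoin, hZ, Finset.coe_insert]
  have hZO : ∀ z ∈ Z, z ∈ O ∧ z ∈ (⊤ : Subfield K) := by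
    intro z hz
    refine ⟨?_, Subfield.mem_top z⟩
    rw [hZ, Finset.mem_insert] at hz
    rcases hz with rfl | hz
    · exact htO
    · exact h₀ (hs ▸ Algebra.subset_adjoin hz)
  -- `K/k` is finitely generated: `K = k(Z)`
  have hKfg : FGOver Kf (⊤ : Subfield K) := by
    refine ⟨Z, top_le_iff.mp fun z _ => ?_⟩
    let F : Subalgebra k K :=
      { (Subfield.closure ((Kf : Set K) ∪ ↑Z)).toSubring with
        algebraMap_mem' := fun c => Subfield.subset_closure (Or.inl ⟨c, rfl⟩) }
    have hRF : R ≤ F := by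
      rw [hRZ]
      exact Algebra.adjoin_le fun x hx => Subfield.subset_closure (Or.inr hx)
    obtain ⟨a, b, -, rfl⟩ := IsFractionRing.div_surjective (A := R) z
    exact div_mem (hRF a.2) (hRF b.2)
  have hKO : ((Kf : Subfield K) : Set K) ⊆ O := by
    rintro _ ⟨c, rfl⟩
    exact h₀ (A₀.algebraMap_mem c)
  -- Knaf–Kuhlmann 2005, Thm. 1.1 (PROVED in the tree)
  obtain ⟨A', hA'O, -, hfp, hfrac', hsm, hZA⟩ :=
    KnafKuhlmann2005_Thm11_holds K O Kf ⊤ le_top hKfg hKO hAbh hsep Z hZO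
  haveI := hfp
  haveI := hsm
  -- smooth over a field at the centre ⇒ regular local ring (EGA IV 17.5.8, PROVED in the tree)
  have hreg' : IsRegularLocalRing (Localization.AtPrime (centre A' O hA'O)) :=
    isRegularLocalRing_of_isSmoothAt Kf A' (centre A' O hA'O)
  -- the same model as a `k`-subalgebra
  set A'' : Subalgebra k K := restrictGround A' with hA''
  have hA''O : A''.toSubring ≤ O.toSubring := hA'O
  have hreg'' : IsRegularLocalRing (Localization.AtPrime
      ((maximalIdeal O).comap (Subring.inclusion hA''O))) := hreg'
  have hA''fg : A''.FG := by
    haveI : Algebra.FiniteType Kf A' := inferInstance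
    obtain ⟨s', hs'⟩ := A'.fg_iff_finiteType.mpr this
    refine ⟨s', Subalgebra.toSubring_injective ?_⟩
    rw [← adjoin_groundSubfield_toSubring, hs']
    rfl
  haveI hfrA'' : IsFractionRing A''.toSubring K := by
    refine IsFractionRing.of_field A''.toSubring K fun z => ?_
    obtain ⟨a, ha, b, hb, rfl⟩ := hfrac' z (Subfield.mem_top z)
    exact ⟨⟨a, ha⟩, ⟨b, hb⟩, rfl⟩
  -- `Z`, hence `R = k[Z]`, lies in the local ring `Λ'' = A''_𝔮 ⊆ K`
  set Λ : Subalgebra A''.toSubring K := Localization.subalgebra.ofField K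
    ((maximalIdeal O).comap (Subring.inclusion hA''O)).primeCompl
    (Ideal.primeCompl_le_nonZeroDivisors _) with hΛ
  have hZΛ : ∀ z ∈ Z, z ∈ Λ := by
    intro z hz
    obtain ⟨a, ha, b, hb, hb1, rfl⟩ := hZA z hz
    rw [hΛ, mem_centreLocalization_iff]
    exact ⟨a, ha, b, hb, hb1, div_eq_mul_inv a b⟩
  let Λk : Subalgebra k K :=
    { Λ.toSubring with
      algebraMap_mem' := fun c => le_centreLocalization O A'' hA''O (A''.algebraMap_mem c) }
  have hRΛ : (R : Set K) ⊆ Λ := by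
    change R ≤ Λk
    rw [hRZ]
    exact Algebra.adjoin_le fun z hz => hZΛ z hz
  -- the model `A = A'' ⊔ R = A''[Z]`
  set A : Subalgebra k K := A'' ⊔ R with hA
  have hAO : A.toSubring ≤ O.toSubring := by
    let Oalg : Subalgebra k K :=
      { O.toSubring with algebraMap_mem' := fun c => h₀ (A₀.algebraMap_mem c) }
    change A ≤ Oalg
    exact sup_le (fun x hx => hA''O hx) (fun x hx => hRO hx)
  have hRA : R ≤ A := le_sup_right
  haveI : IsFractionRing R.toSubring K := hfr
  haveI : IsFractionRing A.toSubring K := isFractionRing_subalgebra_of_le R A hRA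
  have hAΛ : (A : Set K) ⊆ Λ := by
    change A ≤ Λk
    exact sup_le (fun x hx => le_centreLocalization O A'' hA''O hx) (fun x hx => hRΛ hx)
  have heq : ((Localization.subalgebra.ofField K
      ((maximalIdeal O).comap (Subring.inclusion hAO)).primeCompl
      (Ideal.primeCompl_le_nonZeroDivisors _)) : Set K) = Λ :=
    le_antisymm (centreLocalization_le O A A'' hAO hA''O hAΛ)
      (centreLocalization_le O A'' A hA''O hAO fun x hx =>
        le_centreLocalization O A hAO (le_sup_left (a := A'') hx))
  refine ⟨A, hAO, (le_adjoin_insert A₀ t).trans hRA, hRA (mem_adjoin_insert A₀ t),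
    hA''fg.sup (fg_adjoin_insert ⟨s, hs⟩ t), isFractionRing_of_le hRA hfr, ?_⟩
  exact isRegularLocalRing_of_centreLocalization_eq O A A'' hAO hA''O heq hreg''

end Abhyankar

/-! ## §3e Twins and bookkeeping -/

section Twins

open Literature.AlgebraicGeometry.Resolution

variable {k K : Type} [Field k] [Field K] [Algebra k K]

/-- **The tame and characteristic-zero twins.** The body of the crux with `t ^ n ∈ A₀` for an
ARBITRARY exponent `n` and an ARBITRARY characteristic `ℓ` of `k` (so: Kummer `μ_n`-covers as
well as `α_p`/`μ_p`-torsors) follows from resolution in characteristic `ℓ` — the regularity of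
the base and the shape of the cover are irrelevant to this implication. For `ℓ = 0` this is a
THEOREM modulo the vendored `Hironaka1964` (`concl_charZero_of_hironaka`); for `ℓ > 0` and
`trdeg ≥ 4` the TAME twin (`ℓ ∤ n`) is open as well (tame push-down along non-Abhyankar
valuations, Kuhlmann's problem), so `CharP k p` in the crux is load-bearing for the MECHANISM
(purely inseparable = "all bad things happen", Temkin Rem. 1.3.4 (iii)), not for truth. -/
theorem concl_of_resolutionInChar {ℓ : ℕ} [CharP k ℓ] (h : ResolutionInChar.{0} ℓ)
    (O : ValuationSubring K) (A₀ : Subalgebra k K) (h₀ : A₀.toSubring ≤ O.toSubring) (t : K)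
    (hfg : A₀.FG) {n : ℕ} (hn : n ≠ 0) (htn : t ^ n ∈ A₀)
    (hfr : IsFractionRing (Algebra.adjoin k (insert t (A₀ : Set K))) K) :
    ∃ (A : Subalgebra k K) (h : A.toSubring ≤ O.toSubring), A₀ ≤ A ∧ t ∈ A ∧ A.FG ∧
      IsFractionRing A K ∧ IsRegularLocalRing (Localization.AtPrime
        (Ideal.comap (Subring.inclusion h) (IsLocalRing.maximalIdeal O))) :=
  concl_of_relLU O (h.relLocalUniformization k K O) A₀ h₀ t hfg (mem_of_pow_mem O hn (h₀ htn)) hfr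

/-- The characteristic-zero twin of the crux (any exponent `n`) holds modulo `Hironaka1964`
(Zariski 1940 read backwards through the valuative criterion, tree `ResolutionLU`). -/
theorem concl_charZero_of_hironaka [CharZero k] (h : Hironaka1964.{0})
    (O : ValuationSubring K) (A₀ : Subalgebra k K) (h₀ : A₀.toSubring ≤ O.toSubring) (t : K)
    (hfg : A₀.FG) {n : ℕ} (hn : n ≠ 0) (htn : t ^ n ∈ A₀)
    (hfr : IsFractionRing (Algebra.adjoin k (insert t (A₀ : Set K))) K) :
    ∃ (A : Subalgebra k K) (h : A.toSubring ≤ O.toSubring), A₀ ≤ A ∧ t ∈ A ∧ A.FG ∧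
      IsFractionRing A K ∧ IsRegularLocalRing (Localization.AtPrime
        (Ideal.comap (Subring.inclusion h) (IsLocalRing.maximalIdeal O))) :=
  haveI : CharP k 0 := CharP.ofCharZero k
  concl_of_resolutionInChar h O A₀ h₀ t hfg hn htn hfr

/-- **The conjunct `IsFractionRing A K` of the conclusion is redundant**: it follows from
`A₀ ≤ A`, `t ∈ A` and `Frac (A₀[t]) = K`. (Provers may drop it from every intermediate goal.) -/
theorem frac_conjunct_redundant (A₀ A : Subalgebra k K) (t : K) (hle : A₀ ≤ A) (ht : t ∈ A)
    (hfr : IsFractionRing (Algebra.adjoin k (insert t (A₀ : Set K))) K) : IsFractionRing A K := by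
  refine isFractionRing_of_le (Algebra.adjoin_le ?_) hfr
  rintro x (rfl | hx)
  · exact ht
  · exact hle hx

end Twins

/-! ## §3f `A.FG` in the conclusion is load-bearing (junk model `A := O`) -/

section WithoutFGConclusion

variable {k K : Type} [Field k] [Field K] [Algebra k K]

/-- The conclusion of the crux WITHOUT `A.FG` (any subring `A` with `A₀[t] ⊆ A ⊆ O`,
`Frac A = K`, Noetherian regular local ring at the centre). -/
def ConclWithoutFG (O : ValuationSubring K) (A₀ : Subalgebra k K) (t : K) : Prop :=
  ∃ (A : Subalgebra k K) (h : A.toSubring ≤ O.toSubring), A₀ ≤ A ∧ t ∈ A ∧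
    IsFractionRing A K ∧ IsRegularLocalRing (Localization.AtPrime
      (Ideal.comap (Subring.inclusion h) (IsLocalRing.maximalIdeal O)))

/-- **`A.FG` in the CONCLUSION is load-bearing against the junk model `A := O`.** If the valuation
ring `O` is DISCRETE of rank one (a DVR — e.g. every zero-dimensional arc valuation, Abhyankar
or not, defect or not), then WITHOUT the finite generation requirement the conclusion holds
trivially with `A := O` itself: the localisation of `O` at its maximal ideal is `O`, a regular
local ring. Neither the regularity of the base nor the torsor shape nor `trdeg` is used. So any
formalisation of LU that forgets `A.FG` (or "essentially of finite type") proves nothing along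
discrete valuations; the crux states it correctly. -/
theorem conclWithoutFG_of_isDiscreteValuationRing (O : ValuationSubring K)
    [IsDiscreteValuationRing O] (A₀ : Subalgebra k K) (h₀ : A₀.toSubring ≤ O.toSubring) (t : K)
    (htO : t ∈ O) : ConclWithoutFG O A₀ t := by
  classical
  let A : Subalgebra k K := { O.toSubring with algebraMap_mem' := fun c => h₀ (A₀.algebraMap_mem c) }
  have hA : A.toSubring ≤ O.toSubring := le_rfl
  have hAO : A.toSubring = O.toSubring := rfl
  refine ⟨A, hA, fun x hx => h₀ hx, htO, ?_, ?_⟩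
  · exact IsFractionRing.of_field A K fun z => by
      rcases ValuationSubring.mem_or_inv_mem O z with hz | hz
      · exact ⟨⟨z, hz⟩, 1, by simp⟩
      · refine ⟨1, ⟨z⁻¹, hz⟩, ?_⟩
        simp
  · -- the centre is the maximal ideal of `O = A`, and `O` localised at it is `O`
    set 𝔮 : Ideal A.toSubring := Ideal.comap (Subring.inclusion hA) (maximalIdeal O) with h𝔮
    -- `A.toSubring` is (literally) `O.toSubring`; transport the DVR structure
    let e : A.toSubring ≃+* O := RingEquiv.subringCongr hAO
    haveI : IsDomain A.toSubring := inferInstance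
    haveI : IsLocalRing A.toSubring := e.symm.isLocalRing
    haveI : IsPrincipalIdealRing A.toSubring := IsPrincipalIdealRing.of_surjective e.symm.toRingHom e.symm.surjective
    haveI : IsNoetherianRing A.toSubring := inferInstance
    have h𝔮max : 𝔮 = maximalIdeal A.toSubring := by
      rw [h𝔮]
      ext x
      rw [Ideal.mem_comap, IsLocalRing.mem_maximalIdeal, IsLocalRing.mem_maximalIdeal, mem_nonunits_iff,
        mem_nonunits_iff, not_iff_not]
      constructor
      · intro hu
        have := hu.map e.symm
        rwa [show e.symm (Subring.inclusion hA x) = x from Subtype.ext rfl] at this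
      · intro hu
        have := hu.map e
        rwa [show e x = Subring.inclusion hA x from Subtype.ext rfl] at this
    -- localising a local ring at its maximal ideal changes nothing
    have hunits : ∀ x ∈ 𝔮.primeCompl, IsUnit x := by
      intro x hx
      have hx' : x ∉ 𝔮 := fun h => hx h
      rw [h𝔮max] at hx'
      by_contra hnu
      exact hx' ((IsLocalRing.mem_maximalIdeal x).mpr hnu)
    let f : A.toSubring ≃ₐ[A.toSubring] Localization.AtPrime 𝔮 := IsLocalization.atUnits _ 𝔮.primeCompl hunits
    haveI : IsRegularLocalRing A.toSubring := inferInstance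
    exact IsRegularLocalRing.of_ringEquiv f.toRingEquiv

end WithoutFGConclusion

/-! ## §4 False natural strengthenings -/

section SameModel

open Literature.AlgebraicGeometry.Resolution Polynomial

/-- STRENGTHENING 1 — **"no blowing up needed": the model `A₀[t]` itself is regular at the
centre.** (The crux with `A := A₀[t]` forced.) -/
def SameModel (p : ℕ) : Prop :=
  ∀ (k K : Type) [Field k] [CharP k p] [Field K] [Algebra k K] (O : ValuationSubring K)
    (A₀ : Subalgebra k K) (h₀ : A₀.toSubring ≤ O.toSubring) (t : K), A₀.FG → t ^ p ∈ A₀ →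
    IsFractionRing (Algebra.adjoin k (insert t (A₀ : Set K))) K →
    IsRegularLocalRing (Localization.AtPrime (Ideal.comap (Subring.inclusion h₀)
      (IsLocalRing.maximalIdeal O))) →
    ∀ (h : (Algebra.adjoin k (insert t (A₀ : Set K))).toSubring ≤ O.toSubring),
      IsRegularLocalRing (Localization.AtPrime (Ideal.comap (Subring.inclusion h)
        (IsLocalRing.maximalIdeal O)))

variable (p : ℕ) [hp : Fact p.Prime]

/-- Every element of `k[X^p, X^(p+1)] ⊆ k(X)` is a polynomial without linear term. -/
theorem coeff_one_eq_zero_of_mem_adjoin (k : Type) [Field k] {y : RatFunc k}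
    (hy : y ∈ Algebra.adjoin k ({(RatFunc.X : RatFunc k) ^ (p + 1), RatFunc.X ^ p} :
      Set (RatFunc k))) :
    ∃ q : k[X], q.coeff 1 = 0 ∧ algebraMap k[X] (RatFunc k) q = y := by
  induction hy using Algebra.adjoin_induction with
  | mem x hx =>
    rcases hx with rfl | rfl
    · refine ⟨X ^ (p + 1), ?_, by simp⟩
      rw [Polynomial.coeff_X_pow, if_neg]
      have := hp.out.two_le
      omega
    · refine ⟨X ^ p, ?_, by simp⟩
      rw [Polynomial.coeff_X_pow, if_neg]
      have := hp.out.two_le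
      omega
  | algebraMap c => exact ⟨C c, Polynomial.coeff_C_succ, rfl⟩
  | add x y _ _ hx hy =>
    obtain ⟨qx, hqx, rfl⟩ := hx
    obtain ⟨qy, hqy, rfl⟩ := hy
    exact ⟨qx + qy, by simp [hqx, hqy], by simp⟩
  | mul x y _ _ hx hy =>
    obtain ⟨qx, hqx, rfl⟩ := hx
    obtain ⟨qy, hqy, rfl⟩ := hy
    refine ⟨qx * qy, ?_, by simp⟩
    simp [Polynomial.coeff_mul, Finset.Nat.sum_antidiagonal_succ, hqx, hqy]

/-- **Strengthening 1 is FALSE in every characteristic `p`, already for curves**: `k = 𝔽_p`,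
`K = 𝔽_p(X)`, `A₀ = k[X^p]` (regular: a principal ideal domain), `t = X^(p+1)`
(`t^p = (X^p)^(p+1) ∈ A₀`, `t ∉ Frac A₀ = k(X^p)`, `Frac (A₀[t]) = k(X)`), `O` = the `X`-adic
valuation ring. The model `A₀[t] = k[X^p, X^(p+1)]` (the monomial curve of the semigroup
`⟨p, p+1⟩`, for `p = 2` the cusp `k[X², X³]`) is NOT regular at the origin: if it were, its local
ring would be normal (`isIntegrallyClosed_of_isRegularLocalRing`), hence would contain `X`
(integral: `X^p ∈ A₀`), i.e. `X·s = a` with `a, s ∈ k[X^p, X^(p+1)]`, `s(0) ≠ 0` — compare the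
coefficients of `X¹`. So any proof of the crux must CHANGE THE MODEL (blow up / normalise); the
conclusion `∃ A ⊇ A₀[t]` cannot be sharpened to `A = A₀[t]`, not even generically in `p`. -/
theorem not_sameModel : ¬ SameModel p := by
  classical
  intro H
  let k := ZMod p
  let K := RatFunc (ZMod p)
  let x : K := RatFunc.X
  let v : Valuation K (WithZero (Multiplicative ℤ)) := (Polynomial.idealX k).valuation K
  let O : ValuationSubring K := v.valuationSubring
  have hp0 : p ≠ 0 := hp.out.ne_zero
  -- polynomials lie in `O`
  have hpolyO : ∀ q : k[X], algebraMap k[X] K q ∈ O := fun q => by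
    change v (algebraMap k[X] K q) ≤ 1
    rw [IsDedekindDomain.HeightOneSpectrum.valuation_of_algebraMap]
    exact IsDedekindDomain.HeightOneSpectrum.intValuation_le_one _ _
  have hxO : x ∈ O := by have := hpolyO X; rwa [RatFunc.algebraMap_X] at this
  -- the base `A₀ = k[X^p]`
  let A₀ : Subalgebra k K := Algebra.adjoin k {x ^ p}
  have hA₀fg : A₀.FG := by
    simpa [A₀] using Subalgebra.fg_adjoin_finset ({x ^ p} : Finset K)
  have hkO : ∀ c : k, algebraMap k K c ∈ O := fun c => by
    have := hpolyO (C c); rwa [RatFunc.algebraMap_C] at this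
  have h₀ : A₀.toSubring ≤ O.toSubring := by
    let Oalg : Subalgebra k K := { O.toSubring with algebraMap_mem' := hkO }
    change A₀ ≤ Oalg
    exact Algebra.adjoin_le (Set.singleton_subset_iff.mpr (pow_mem hxO p))
  -- `A₀` is a principal ideal domain (image of `k[Y]`), hence regular at every prime
  have hreg₀ : IsRegularLocalRing (Localization.AtPrime (Ideal.comap (Subring.inclusion h₀)
      (IsLocalRing.maximalIdeal O))) := by
    let f : k[X] →+* A₀.toSubring := (Polynomial.aeval (x ^ p)).toRingHom.codRestrict
      A₀.toSubring fun q => Polynomial.aeval_mem_adjoin_singleton k _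
    have hf : Function.Surjective f := by
      rintro ⟨y, hy⟩
      have hy' : y ∈ (Polynomial.aeval (R := k) (x ^ p)).range := by
        rwa [← Algebra.adjoin_singleton_eq_range_aeval]
      obtain ⟨q, rfl⟩ := hy'
      exact ⟨q, rfl⟩
    haveI : IsPrincipalIdealRing A₀.toSubring := IsPrincipalIdealRing.of_surjective f hf
    infer_instance
  -- `t = X^(p+1)`, `t^p ∈ A₀`
  let t : K := x ^ (p + 1)
  have htp : t ^ p ∈ A₀ := by
    have : t ^ p = (x ^ p) ^ (p + 1) := by rw [← pow_mul, ← pow_mul, mul_comm]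
    rw [this]
    exact pow_mem (Algebra.self_mem_adjoin_singleton k _) _
  -- the model `A = A₀[t] = k[X^(p+1), X^p]`
  set A : Subalgebra k K := Algebra.adjoin k (insert t (A₀ : Set K)) with hA
  have hAeq : A = Algebra.adjoin k {x ^ (p + 1), x ^ p} := by
    rw [hA, Algebra.adjoin_insert_adjoin]
  -- `X^m ∈ A` for `m ≥ p²`
  have hpow : ∀ q r : ℕ, r < p → x ^ (p ^ 2 + (p * q + r)) ∈ A := by
    intro q r hr
    induction q with
    | zero =>
      have hrp : r ≤ p := hr.le
      have : p ^ 2 + (p * 0 + r) = (p + 1) * r + p * (p - r) := by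
        zify [hrp]; ring
      rw [this, pow_add, pow_mul, pow_mul]
      refine A.mul_mem (pow_mem ?_ _) (pow_mem ?_ _)
      · rw [hAeq]; exact Algebra.subset_adjoin (by simp)
      · rw [hAeq]; exact Algebra.subset_adjoin (by simp)
    | succ q ih =>
      have : p ^ 2 + (p * (q + 1) + r) = p + (p ^ 2 + (p * q + r)) := by ring
      rw [this, pow_add]
      refine A.mul_mem ?_ ih
      rw [hAeq]; exact Algebra.subset_adjoin (by simp)
  have hpow' : ∀ m : ℕ, x ^ (p ^ 2 + m) ∈ A := fun m => by
    have hm : m = p * (m / p) + m % p := (Nat.div_add_mod m p).symm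
    rw [hm]
    exact hpow _ _ (Nat.mod_lt _ hp.out.pos)
  have hmul : ∀ q : k[X], x ^ (p ^ 2) * algebraMap k[X] K q ∈ A := by
    intro q
    induction q using Polynomial.induction_on' with
    | add q₁ q₂ h₁ h₂ => rw [map_add, mul_add]; exact A.add_mem h₁ h₂
    | monomial n c =>
      rw [← Polynomial.C_mul_X_pow_eq_monomial, map_mul, map_pow, RatFunc.algebraMap_X,
        RatFunc.algebraMap_C, mul_left_comm, ← pow_add]
      have : (RatFunc.C c : K) = algebraMap k K c := rfl
      rw [this]
      exact A.mul_mem (A.algebraMap_mem c) (hpow' n)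
  have hfr : IsFractionRing A K := by
    refine IsFractionRing.of_field A K fun z => ?_
    refine ⟨⟨_, hmul z.num⟩, ⟨_, hmul z.denom⟩, ?_⟩
    have hx0 : (x ^ (p ^ 2) : K) ≠ 0 := pow_ne_zero _ RatFunc.X_ne_zero
    have hd0 : algebraMap k[X] K z.denom ≠ 0 := by
      simpa using z.denom_ne_zero
    change z = (x ^ (p ^ 2) * algebraMap k[X] K z.num) / (x ^ (p ^ 2) * algebraMap k[X] K z.denom)
    rw [mul_div_mul_left _ _ hx0, RatFunc.num_div_denom]
  have hAO : A.toSubring ≤ O.toSubring := adjoin_insert_le O A₀ h₀ (pow_mem hxO _)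
  -- the strengthening would make `A` regular at the centre
  have hregA := H k K O A₀ h₀ t hA₀fg htp hfr hreg₀ hAO
  -- then the local ring `Λ ⊆ K` of `A` at the centre is normal, so `X ∈ Λ`
  haveI : IsFractionRing A.toSubring K := hfr
  set Λ : Subalgebra A.toSubring K := Localization.subalgebra.ofField K
    ((maximalIdeal O).comap (Subring.inclusion hAO)).primeCompl
    (Ideal.primeCompl_le_nonZeroDivisors _) with hΛ
  have hregΛ : IsRegularLocalRing Λ := (isRegularLocalRing_iff_centreLocalization O A hAO).mp hregA
  haveI : IsIntegrallyClosed Λ := isIntegrallyClosed_of_isRegularLocalRing Λ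
  have hxΛ : x ∈ Λ := by
    have hxpΛ : x ^ p ∈ Λ :=
      le_centreLocalization O A hAO (le_adjoin_insert A₀ t (Algebra.self_mem_adjoin_singleton k _))
    have hint : IsIntegral Λ x :=
      ⟨Polynomial.X ^ p - Polynomial.C ⟨x ^ p, hxpΛ⟩, Polynomial.monic_X_pow_sub_C _ hp0, by
        simp [Polynomial.eval₂_sub, Polynomial.eval₂_X_pow, Polynomial.eval₂_C]⟩
    obtain ⟨y, hy⟩ := IsIntegrallyClosed.algebraMap_eq_of_integral hint
    rw [← hy]
    exact y.2
  -- write `X = a / s` with `a, s ∈ A`, `v(s) = 1`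
  rw [hΛ, mem_centreLocalization_iff] at hxΛ
  obtain ⟨a, ha, s, hs, hs1, hxas⟩ := hxΛ
  rw [hAeq] at ha hs
  obtain ⟨qa, hqa1, rfl⟩ := coeff_one_eq_zero_of_mem_adjoin p k ha
  obtain ⟨qs, hqs1, rfl⟩ := coeff_one_eq_zero_of_mem_adjoin p k hs
  -- `v(s) = 1` says `X ∤ qs`, i.e. `qs(0) ≠ 0`
  have hqs0 : qs.coeff 0 ≠ 0 := by
    have hv1 : v (algebraMap k[X] K qs) = 1 :=
      (Valuation.isEquiv_valuation_valuationSubring v).eq_one_iff_eq_one.mpr hs1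
    rw [IsDedekindDomain.HeightOneSpectrum.valuation_of_algebraMap,
      IsDedekindDomain.HeightOneSpectrum.intValuation_eq_one_iff, Polynomial.idealX_span,
      Ideal.mem_span_singleton, Polynomial.X_dvd_iff] at hv1
    exact hv1
  -- `X * qs = qa`: compare the coefficients of `X¹`
  have hs0 : algebraMap k[X] K qs ≠ 0 := by
    intro h0
    rw [h0, map_zero] at hs1
    exact zero_ne_one hs1
  have heqK : algebraMap k[X] K (X * qs) = algebraMap k[X] K qa := by
    rw [map_mul, RatFunc.algebraMap_X]
    change x * _ = _
    rw [hxas, inv_mul_cancel_right₀ hs0]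
  have heq : X * qs = qa := RatFunc.algebraMap_injective k heqK
  have := congrArg (fun q : k[X] => q.coeff 1) heq
  simp only [Polynomial.coeff_X_mul, hqa1] at this
  exact hqs0 this

end SameModel

section OverDVR

open Literature.AlgebraicGeometry.Resolution
open Literature.Barriers.ResolutionOfSingularities.QuasiExcellence
open scoped LaurentSeries PowerSeries IntermediateField

/-- STRENGTHENING 2 — **the "pure local algebra" form of the crux over an arbitrary regular base.**
Replace "`A₀` finitely generated over a field `k`, regular at the centre" by "`S` a regular local
ring" — here even a DISCRETE VALUATION RING of characteristic `p` dominated by `O` — and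
"finitely generated over `k`" by "finitely generated over `S`"; keep the torsor shape `t ^ p ∈ S`,
`F = Frac (S[t])`. (This is what a proof "by commutative algebra of the regular local ring
`(A₀)_𝔭` alone" would establish.) -/
def TorsorOverDVR (p : ℕ) : Prop :=
  ∀ (S F : Type) [CommRing S] [IsDomain S] [IsDiscreteValuationRing S] [CharP S p] [Field F]
    [Algebra S F] (O : ValuationSubring F) (t : F),
    Function.Injective (algebraMap S F) →
    (∀ s : S, algebraMap S F s ∈ O) →
    (∀ s : S, s ∈ IsLocalRing.maximalIdeal S → O.valuation (algebraMap S F s) < 1) →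
    t ^ p ∈ (algebraMap S F).range →
    IsFractionRing (Algebra.adjoin S ({t} : Set F)) F →
    ∃ (A : Subalgebra S F) (h : A.toSubring ≤ O.toSubring), t ∈ A ∧ A.FG ∧ IsFractionRing A F ∧
      IsRegularLocalRing (Localization.AtPrime (Ideal.comap (Subring.inclusion h)
        (IsLocalRing.maximalIdeal O)))

/-- If `s ∈ A ⊆ F` and `s⁻¹` is integral over the subring `A`, then `s⁻¹ ∈ A`
(`s⁻¹ = -(c_{n-1} + c_{n-2} s + ⋯ + c₀ s^{n-1})` from the monic equation of `s⁻¹`). -/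
theorem inv_mem_of_isIntegral_inv {F : Type*} [Field F] {A : Subring F} {s : F} (hs : s ∈ A)
    (hint : IsIntegral A s⁻¹) : s⁻¹ ∈ A := by
  rcases eq_or_ne s 0 with rfl | hs0
  · rw [inv_zero]; exact A.zero_mem
  obtain ⟨q, hmon, hq⟩ := hint
  set n := q.natDegree with hn
  rw [Polynomial.eval₂_eq_sum_range, Finset.sum_range_succ, ← hn, hmon.coeff_natDegree, map_one,
    one_mul] at hq
  -- `hq : (∑ i < n, cᵢ s⁻ⁱ) + s⁻ⁿ = 0`; multiply by `sⁿ`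
  set w : F := ∑ i ∈ Finset.range n, algebraMap A F (q.coeff i) * s ^ (n - 1 - i) with hw
  have hwA : w ∈ A := by
    refine Subring.sum_mem _ fun i _ => Subring.mul_mem _ (q.coeff i).2 (Subring.pow_mem _ hs _)
  have hkey : (∑ i ∈ Finset.range n, algebraMap A F (q.coeff i) * s⁻¹ ^ i) * s ^ n = s * w := by
    rw [hw, Finset.sum_mul, Finset.mul_sum]
    refine Finset.sum_congr rfl fun i hi => ?_
    rw [Finset.mem_range] at hi
    have hsplit : s ^ n = s ^ i * (s * s ^ (n - 1 - i)) := by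
      rw [← pow_succ', ← pow_add]; congr 1; omega
    rw [hsplit, inv_pow, mul_assoc, ← mul_assoc ((s ^ i)⁻¹), inv_mul_cancel₀ (pow_ne_zero _ hs0),
      one_mul, mul_left_comm]
  have h1 : s * w + 1 = 0 := by
    have := congrArg (· * s ^ n) hq
    simp only [add_mul, zero_mul, hkey] at this
    rwa [inv_pow, inv_mul_cancel₀ (pow_ne_zero _ hs0)] at this
  have hinv : s⁻¹ = -w := by
    rw [eq_neg_iff_add_eq_zero, ← mul_right_inj' hs0, mul_add, mul_inv_cancel₀ hs0, mul_zero,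
      add_comm]
    exact h1
  rw [hinv]
  exact A.neg_mem hwA

variable (p : ℕ) [hp : Fact p.Prime]

/-- F. K. Schmidt's discrete valuation ring `S = K ∩ 𝔽_p⟦X⟧` of a subfield `K ⊆ 𝔽_p((X))`
(the tree's witness for `Nagata1962_nonFiniteNormalization`). -/
abbrev SchmidtS (K : IntermediateField (ZMod p) (ZMod p)⸨X⸩) : ValuationSubring K :=
  (Valued.v.comap (algebraMap K (ZMod p)⸨X⸩)).valuationSubring

/-- The field `F = K(f) ⊆ 𝔽_p((X))`. -/
abbrev SchmidtF (K : IntermediateField (ZMod p) (ZMod p)⸨X⸩) (f : (ZMod p)⟦X⟧) : Type :=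
  ↥K⟮(f : (ZMod p)⸨X⸩)⟯

/-- The valuation ring `O = F ∩ 𝔽_p⟦X⟧` of `F` (the restriction of the `X`-adic valuation). -/
abbrev SchmidtO (K : IntermediateField (ZMod p) (ZMod p)⸨X⸩) (f : (ZMod p)⟦X⟧) :
    ValuationSubring (SchmidtF p K f) :=
  (Valued.v.comap (algebraMap (SchmidtF p K f) (ZMod p)⸨X⸩)).valuationSubring

set_option maxHeartbeats 1600000 in
set_option synthInstance.maxHeartbeats 200000 in
/-- **Strengthening 2 is FALSE: excellence (Japanese-ness) of the base is load-bearing.** Witness: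
F. K. Schmidt's / Nagata's discrete valuation ring `S = K ∩ 𝔽_p⟦X⟧`, `K = 𝔽_p(X, f^p) ⊂ 𝔽_p((X))`
(`f ∈ X𝔽_p⟦X⟧` transcendental), `t = f`, `F = K(f)` (degree `p`, purely inseparable, `f^p ∈ S`),
`O = F ∩ 𝔽_p⟦X⟧` the unique valuation ring of `F` over `S` — the tree's PROVED
`Nagata1962_nonFiniteNormalization` witness (Kollár, *Lectures on Resolution*, Ex. 1.103 /
Claim 1.104: the integral closure of `S` in `F` is not a finite `S`-module). If some finitely
generated `S`-algebra `A ∋ t` inside `O` with `Frac A = F` were regular at the centre `𝔮`, then: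
every element of `O` is integral over `S` (`y ^ p ∈ S` by Frobenius), so `A` is finite over `S`;
`A_𝔮` is a regular local ring of dimension `≤ dim A = dim S = 1`, hence a principal ideal domain
(tree: `isPrincipalIdealRing_of_ringKrullDim_le_one`), hence a valuation ring of `F` dominated by
`O`, so `O ⊆ A_𝔮`; an element `s ∈ A ∖ 𝔮` has `s⁻¹ ∈ O` integral over `A`, so `s⁻¹ ∈ A`
(`inv_mem_of_isIntegral_inv`) and `A_𝔮 = A`; thus the integral closure of `S` in `F` lies in the
finite `S`-module `A` — contradiction. MORAL FOR PROVERS: no argument that only uses "the base is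
a regular local ring + the extension is `t^p = a`" can prove the crux; the proof must use that
`A₀` is of finite type over a FIELD (excellent: finiteness of normalisation in purely inseparable
extensions, openness of the regular locus), exactly the input that fails for Nagata's rings
(barrier `QuasiExcellenceNecessary`). Already in relative dimension ONE over the base. -/
theorem not_torsorOverDVR : ¬ TorsorOverDVR p := by
  classical
  intro H
  obtain ⟨f, K, ht, hzp, hz, hvz⟩ := Nagata1962.exists_data p
  letI : Algebra (SchmidtS p K) (SchmidtF p K f) :=
    ((algebraMap K (SchmidtF p K f)).comp (algebraMap (SchmidtS p K) K)).toAlgebra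
  haveI : IsScalarTower (SchmidtS p K) K (SchmidtF p K f) :=
    IsScalarTower.of_algebraMap_eq fun _ => rfl
  haveI := Nagata1962.isDiscreteValuationRing p K ht
  haveI : CharP (SchmidtS p K) p := Nagata1962.charP_valuationSubring p K
  haveI : CharP (ZMod p)⸨X⸩ p := SchmidtDefect.charP_laurentSeries p
  have hinj : Function.Injective (algebraMap (SchmidtS p K) (SchmidtF p K f)) :=
    (algebraMap K (SchmidtF p K f)).injective.comp Subtype.val_injective
  have hcoe : ∀ s : SchmidtS p K, ((algebraMap (SchmidtS p K) (SchmidtF p K f) s :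
      SchmidtF p K f) : (ZMod p)⸨X⸩) = ((s : K) : (ZMod p)⸨X⸩) := fun s => rfl
  -- membership in `O` / value `< 1` is read off in `𝔽_p((X))`
  have hmemO : ∀ y : SchmidtF p K f, y ∈ SchmidtO p K f ↔ Valued.v (y : (ZMod p)⸨X⸩) ≤ 1 :=
    fun y => by rw [Valuation.mem_valuationSubring_iff]; rfl
  have hvalO : ∀ y : SchmidtF p K f,
      (SchmidtO p K f).valuation y < 1 ↔ Valued.v (y : (ZMod p)⸨X⸩) < 1 := by
    intro y
    rw [← (Valuation.isEquiv_valuation_valuationSubring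
      (Valued.v.comap (algebraMap (SchmidtF p K f) (ZMod p)⸨X⸩))).lt_one_iff_lt_one]
    rfl
  have hSO : ∀ s : SchmidtS p K, algebraMap (SchmidtS p K) (SchmidtF p K f) s ∈ SchmidtO p K f :=
    fun s => by
    rw [hmemO, hcoe]
    exact (Valuation.mem_valuationSubring_iff _ _).mp s.2
  have hdom : ∀ s : SchmidtS p K, s ∈ maximalIdeal (SchmidtS p K) →
      (SchmidtO p K f).valuation (algebraMap (SchmidtS p K) (SchmidtF p K f) s) < 1 :=
    fun s hs => by
    rw [hvalO, hcoe]
    exact (Valuation.mem_maximalIdeal_iff (v := Valued.v.comap (algebraMap K (ZMod p)⸨X⸩))).mp hs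
  -- `t = f`, `t ^ p = f ^ p ∈ S`
  have htp : (IntermediateField.AdjoinSimple.gen K (f : (ZMod p)⸨X⸩) : SchmidtF p K f) ^ p ∈
      (algebraMap (SchmidtS p K) (SchmidtF p K f)).range := by
    refine ⟨⟨⟨(f : (ZMod p)⸨X⸩) ^ p, hzp⟩, Nagata1962.pow_p_mem p K f hzp hvz⟩, ?_⟩
    rw [IsScalarTower.algebraMap_apply (SchmidtS p K) K (SchmidtF p K f)]
    exact (Nagata1962.gen_pow_eq p K f hzp).symm
  -- `Frac (S[t]) = F`
  have hfrS : IsFractionRing (Algebra.adjoin (SchmidtS p K)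
      ({(IntermediateField.AdjoinSimple.gen K (f : (ZMod p)⸨X⸩) : SchmidtF p K f)} : Set (SchmidtF p K f)))
      (SchmidtF p K f) := by
    refine Nagata1962.isFractionRing_subalgebra (S := SchmidtS p K) (K := K)
      (IntermediateField.adjoin.powerBasis (SchmidtDefect.isIntegral_gen p K (f : (ZMod p)⸨X⸩) hzp))
      _ ?_
    rw [IntermediateField.adjoin.powerBasis_gen]
    exact Algebra.self_mem_adjoin_singleton _ _
  -- THE STRENGTHENING would give a regular model `A`
  obtain ⟨A, hAO, -, hAfg, hAfr, hreg⟩ :=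
    H (SchmidtS p K) (SchmidtF p K f) (SchmidtO p K f) _ hinj hSO hdom htp hfrS
  -- (1) every element of `O` is integral over `S`: Frobenius puts `y ^ p` in `K`, and `|y^p| ≤ 1`
  have hfrob : ∀ y : (ZMod p)⸨X⸩, y ∈ Algebra.adjoin K ({(f : (ZMod p)⸨X⸩)} : Set (ZMod p)⸨X⸩) →
      ∃ c : K, (c : (ZMod p)⸨X⸩) = y ^ p := by
    intro y hy
    induction hy using Algebra.adjoin_induction with
    | mem x hx =>
      rw [Set.mem_singleton_iff] at hx
      subst hx
      exact ⟨⟨_, hzp⟩, rfl⟩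
    | algebraMap c => exact ⟨c ^ p, by simp⟩
    | add x y _ _ hx hy =>
      obtain ⟨cx, hcx⟩ := hx
      obtain ⟨cy, hcy⟩ := hy
      exact ⟨cx + cy, by rw [add_pow_char, ← hcx, ← hcy]; rfl⟩
    | mul x y _ _ hx hy =>
      obtain ⟨cx, hcx⟩ := hx
      obtain ⟨cy, hcy⟩ := hy
      exact ⟨cx * cy, by rw [mul_pow, ← hcx, ← hcy]; rfl⟩
  have hOint : ∀ y : SchmidtF p K f, y ∈ SchmidtO p K f → IsIntegral (SchmidtS p K) y := by
    intro y hy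
    have hy' : (y : (ZMod p)⸨X⸩) ∈ Algebra.adjoin K ({(f : (ZMod p)⸨X⸩)} : Set (ZMod p)⸨X⸩) := by
      rw [← IntermediateField.adjoin_simple_toSubalgebra_of_isAlgebraic
        (SchmidtDefect.isIntegral_gen p K (f : (ZMod p)⸨X⸩) hzp).isAlgebraic]
      exact y.2
    obtain ⟨c, hc⟩ := hfrob _ hy'
    have hcS : c ∈ SchmidtS p K := by
      rw [Valuation.mem_valuationSubring_iff]
      change Valued.v (c : (ZMod p)⸨X⸩) ≤ 1
      rw [hc, Valuation.map_pow]
      exact pow_le_one₀ zero_le ((hmemO y).mp hy)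
    refine Nagata1962.isIntegral_of_pow_eq hp.out.ne_zero (s := ⟨c, hcS⟩) ?_
    apply Subtype.ext
    change ((y : (ZMod p)⸨X⸩)) ^ p = ((c : K) : (ZMod p)⸨X⸩)
    rw [hc]
  -- (2) hence `A` is integral and FINITE over `S`
  haveI : Algebra.IsIntegral (SchmidtS p K) A := ⟨fun a =>
    (isIntegral_algHom_iff A.val Subtype.val_injective).mp (hOint _ (hAO a.2))⟩
  haveI : Algebra.FiniteType (SchmidtS p K) A := A.fg_iff_finiteType.mp hAfg
  haveI : Module.Finite (SchmidtS p K) A := Algebra.IsIntegral.finite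
  -- (3) the local ring `Λ = A_𝔮 ⊆ F` at the centre: regular of dimension `≤ 1`, hence a PID,
  --     hence a valuation ring of `F`
  haveI : IsFractionRing A.toSubring (SchmidtF p K f) := hAfr
  set 𝔮 : Ideal A.toSubring := (maximalIdeal (SchmidtO p K f)).comap (Subring.inclusion hAO)
    with h𝔮
  let Λ : Subalgebra A.toSubring (SchmidtF p K f) := Localization.subalgebra.ofField
    (SchmidtF p K f) 𝔮.primeCompl (Ideal.primeCompl_le_nonZeroDivisors _)
  haveI hregΛ : IsRegularLocalRing Λ :=
    (isRegularLocalRing_iff_centreLocalization (SchmidtO p K f) A hAO).mp hreg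
  have hdimA : ringKrullDim A.toSubring = 1 :=
    Nagata1962.ringKrullDim_subalgebra_eq_one (S := SchmidtS p K) A hinj
  have hdimΛ : ringKrullDim Λ ≤ 1 := by
    rw [IsLocalization.AtPrime.ringKrullDim_eq_height 𝔮 Λ, ← hdimA]
    exact Ideal.height_le_ringKrullDim_of_isPrime
  haveI : IsPrincipalIdealRing Λ := isPrincipalIdealRing_of_ringKrullDim_le_one hdimΛ
  haveI : ValuationRing Λ := inferInstance
  -- (4) `O ⊆ Λ`: `Λ` is a valuation ring of `F` dominated by `O`
  have hOΛ : ∀ x : SchmidtF p K f, x ∈ SchmidtO p K f → x ∈ Λ := by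
    intro x hxO
    rcases ValuationRing.isInteger_or_isInteger Λ x with ⟨y, hy⟩ | ⟨y, hy⟩
    · rw [← hy]; exact y.2
    · by_cases hx0 : x = 0
      · rw [hx0]; exact Λ.zero_mem
      have hy' : x⁻¹ ∈ Λ := by rw [← hy]; exact y.2
      rw [mem_centreLocalization_iff] at hy' ⊢
      obtain ⟨a, ha, s, hs, hs1, hxinv⟩ := hy'
      have ha1 : (SchmidtO p K f).valuation a = 1 := by
        apply le_antisymm (((SchmidtO p K f).valuation_le_one_iff a).mpr (hAO ha))
        have hx1 : (SchmidtO p K f).valuation x ≤ 1 :=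
          ((SchmidtO p K f).valuation_le_one_iff x).mpr hxO
        have hvx0 : (SchmidtO p K f).valuation x ≠ 0 := by rwa [Ne, Valuation.zero_iff]
        have : (SchmidtO p K f).valuation x⁻¹ = (SchmidtO p K f).valuation a := by
          rw [hxinv, map_mul, map_inv₀, hs1, inv_one, mul_one]
        rw [← this, map_inv₀]
        exact (one_le_inv₀ (zero_lt_iff.mpr hvx0)).mpr hx1
      refine ⟨s, hs, a, ha, ha1, ?_⟩
      rw [← inv_inv x, hxinv, mul_inv, inv_inv, mul_comm]
  -- (5) units: `s ∈ A`, `v(s) = 1` ⇒ `s⁻¹ ∈ A` (integral over `S ⊆ A`), so `Λ ⊆ A`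
  have hunit : ∀ s : SchmidtF p K f, s ∈ A → (SchmidtO p K f).valuation s = 1 → s⁻¹ ∈ A := by
    intro s hs hs1
    have hsinvO : s⁻¹ ∈ SchmidtO p K f := by
      rw [← (SchmidtO p K f).valuation_le_one_iff, map_inv₀, hs1, inv_one]
    have hint : IsIntegral A.toSubring s⁻¹ := (hOint _ hsinvO).tower_top (A := A)
    exact inv_mem_of_isIntegral_inv (A := A.toSubring) hs hint
  have hΛA : ∀ x : SchmidtF p K f, x ∈ Λ → x ∈ A := by
    intro x hx
    rw [mem_centreLocalization_iff] at hx
    obtain ⟨a, ha, s, hs, hs1, rfl⟩ := hx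
    exact A.mul_mem ha (hunit s hs hs1)
  -- (6) the integral closure of `S` in `F` lies in `A`, hence is finite over `S`: contradiction
  have hTA : integralClosure (SchmidtS p K) (SchmidtF p K f) ≤ A := by
    intro y hy
    refine hΛA y (hOΛ y ?_)
    letI : Algebra (SchmidtS p K) (SchmidtO p K f) :=
      ((algebraMap (SchmidtS p K) (SchmidtF p K f)).codRestrict (SchmidtO p K f).toSubring
        fun s => hSO s).toAlgebra
    haveI : IsScalarTower (SchmidtS p K) (SchmidtO p K f) (SchmidtF p K f) :=
      IsScalarTower.of_algebraMap_eq fun _ => rfl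
    have hint : IsIntegral (SchmidtO p K f) y := ((mem_integralClosure_iff _ _).1 hy).tower_top
    exact (Valuation.valuationSubring.integers
      (Valued.v.comap (algebraMap (SchmidtF p K f) (ZMod p)⸨X⸩))).mem_of_integral hint
  haveI : IsNoetherian (SchmidtS p K) (Subalgebra.toSubmodule A) :=
    isNoetherian_of_isNoetherianRing_of_finite (SchmidtS p K) _
  have hfin : Module.Finite (SchmidtS p K)
      (Subalgebra.toSubmodule (integralClosure (SchmidtS p K) (SchmidtF p K f))) :=
    Module.Finite.of_injective (Submodule.inclusion (Subalgebra.toSubmodule.le_iff_le.mpr hTA))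
      (Submodule.inclusion_injective _)
  exact Nagata1962.not_finite_integralClosure_adjoin p K f ht hzp hz hfin


/-- In a domain, a nonzero element `b` integral over `S` divides (inside `S[b]`) the image of a
nonzero element of `S` (the constant term of its minimal-type equation after removing `X`-powers). -/
theorem exists_mul_eq_algebraMap_of_isIntegral {S B : Type*} [CommRing S] [Nontrivial S] [CommRing B]
    [IsDomain B] [Algebra S B] {b : B} (hb : IsIntegral S b) (hb0 : b ≠ 0) :
    ∃ b' ∈ Algebra.adjoin S ({b} : Set B), ∃ c : S, c ≠ 0 ∧ b * b' = algebraMap S B c := by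
  obtain ⟨q, hqm, hq⟩ := hb
  obtain ⟨q₁, hq₁, hndvd⟩ :=
    Polynomial.exists_eq_pow_rootMultiplicity_mul_and_not_dvd q hqm.ne_zero 0
  simp only [map_zero, sub_zero] at hq₁ hndvd
  have hq₁b : Polynomial.aeval b q₁ = 0 := by
    have h0 : Polynomial.aeval b q = 0 := hq
    rw [hq₁, map_mul, map_pow, Polynomial.aeval_X] at h0
    exact (mul_eq_zero.mp h0).resolve_left (pow_ne_zero _ hb0)
  have hc : q₁.coeff 0 ≠ 0 := by rwa [Ne, ← Polynomial.X_dvd_iff]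
  refine ⟨-(Polynomial.aeval b q₁.divX), Subalgebra.neg_mem _
    (Polynomial.aeval_mem_adjoin_singleton S b), q₁.coeff 0, hc, ?_⟩
  rw [← Polynomial.X_mul_divX_add q₁, map_add, map_mul, Polynomial.aeval_X, Polynomial.aeval_C]
    at hq₁b
  rw [mul_neg, eq_comm, ← sub_eq_zero, sub_neg_eq_add, add_comm]
  exact hq₁b

/-- **The dividing line is exactly excellence**: Strengthening 2 becomes TRUE (in its own relative
dimension one) as soon as the discrete valuation ring `S` is EXCELLENT — local uniformization of
the excellent curve `S[t]` along `O` is finite normalisation (tree: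
`exists_adjoin_isRegularLocalRing_of_ringKrullDim_eq_one`, Kollár Thm. 1.101 / Matsumura 11.2).
So `not_torsorOverDVR` isolates precisely the input (finiteness of normalisation / excellence)
that a proof of the crux must spend; the localisations `(A₀)_𝔭` of the crux are excellent
(essentially of finite type over a field, Stacks 07QW), Nagata's are not. -/
theorem torsorOverDVR_of_isExcellent {p : ℕ} (hp : p ≠ 0) (S F : Type) [CommRing S] [IsDomain S]
    [IsDiscreteValuationRing S] [Field F] [Algebra S F] (hexc : IsExcellentRing S)
    (O : ValuationSubring F) (t : F) (hinj : Function.Injective (algebraMap S F))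
    (hSO : ∀ s : S, algebraMap S F s ∈ O)
    (hdom : ∀ s : S, s ∈ IsLocalRing.maximalIdeal S → O.valuation (algebraMap S F s) < 1)
    (htp : t ^ p ∈ (algebraMap S F).range)
    (hfr : IsFractionRing (Algebra.adjoin S ({t} : Set F)) F) :
    ∃ (A : Subalgebra S F) (h : A.toSubring ≤ O.toSubring), t ∈ A ∧ A.FG ∧ IsFractionRing A F ∧
      IsRegularLocalRing (Localization.AtPrime (Ideal.comap (Subring.inclusion h)
        (IsLocalRing.maximalIdeal O))) := by
  classical
  -- the image `R = ⊥` of `S` in `F`, a local excellent domain of dimension one isomorphic to `S`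
  set R : Subalgebra S F := ⊥ with hR
  let e : S ≃+* R := RingEquiv.ofBijective
    ((Algebra.ofId S F).codRestrict R fun s => Subalgebra.algebraMap_mem _ s)
    ⟨fun a b hab => hinj (congrArg Subtype.val hab), fun ⟨y, hy⟩ => by
      obtain ⟨s, rfl⟩ := Algebra.mem_bot.mp hy
      exact ⟨s, rfl⟩⟩
  have he : ∀ s : S, ((e s : R) : F) = algebraMap S F s := fun s => rfl
  haveI : IsLocalRing R := e.isLocalRing
  haveI : IsLocalRing R.toSubring := ‹IsLocalRing R›
  haveI : Algebra.FiniteType S R :=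
    Algebra.FiniteType.of_surjective
      ((Algebra.ofId S F).codRestrict R fun s => Subalgebra.algebraMap_mem _ s) e.surjective
  have hexcR : IsExcellentRing R.toSubring := hexc.of_finiteType' (B := R)
  haveI : Module.Finite S R := Module.Finite.of_surjective
    (((Algebra.ofId S F).codRestrict R fun s => Subalgebra.algebraMap_mem _ s).toLinearMap)
    e.surjective
  haveI : Algebra.IsIntegral S R := Algebra.IsIntegral.of_finite S R
  have hdimR : ringKrullDim R.toSubring = 1 :=
    Nagata1962.ringKrullDim_subalgebra_eq_one (S := S) R hinj
  have hRO : R.toSubring ≤ O.toSubring := by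
    rintro x hx
    obtain ⟨s, rfl⟩ := Algebra.mem_bot.mp (show x ∈ R from hx)
    exact hSO s
  have hdomR : ∀ r : R.toSubring, r ∈ maximalIdeal R.toSubring → O.valuation (r : F) < 1 := by
    intro r hr
    obtain ⟨s, rfl⟩ : ∃ s, e s = r := e.surjective r
    rw [he]
    refine hdom s ?_
    rw [IsLocalRing.mem_maximalIdeal, mem_nonunits_iff] at hr ⊢
    exact fun hu => hr (hu.map e)
  -- the equation `h = X^p - c` of `t` over `R`
  obtain ⟨c, hc⟩ := htp
  set h : Polynomial R.toSubring := Polynomial.X ^ p - Polynomial.C (e c) with hh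
  have hmon : h.Monic := Polynomial.monic_X_pow_sub_C _ hp
  have hx : Polynomial.aeval t h = 0 := by
    rw [hh, map_sub, map_pow, Polynomial.aeval_X, Polynomial.aeval_C, sub_eq_zero, ← hc]
    rfl
  -- (GEN): denominators from `R`, using integrality of `S[t]` over `S`
  have htint : IsIntegral S t := Nagata1962.isIntegral_of_pow_eq hp (s := c) hc.symm
  haveI : Algebra.IsIntegral S (Algebra.adjoin S ({t} : Set F)) :=
    Algebra.IsIntegral.adjoin (by simpa using htint)
  have hgen : ∀ z : F, ∃ (g : Polynomial R.toSubring) (s : R.toSubring), s ≠ 0 ∧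
      z * s = Polynomial.aeval t g := by
    intro z
    obtain ⟨a, b, hb, rfl⟩ := IsFractionRing.div_surjective (A := Algebra.adjoin S ({t} : Set F)) z
    have hb0 : (b : F) ≠ 0 := fun h0 => nonZeroDivisors.ne_zero hb (Subtype.ext h0)
    have hbint : IsIntegral S (b : F) :=
      (isIntegral_algHom_iff (Algebra.adjoin S ({t} : Set F)).val Subtype.val_injective).mpr
        (Algebra.IsIntegral.isIntegral b)
    obtain ⟨b', hb', c', hc'0, hbb'⟩ := exists_mul_eq_algebraMap_of_isIntegral hbint hb0
    have hb'mem : b' ∈ Algebra.adjoin S ({t} : Set F) :=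
      Algebra.adjoin_le (Set.singleton_subset_iff.mpr b.2) hb'
    -- `a * b' ∈ S[t] = {aeval t g}`
    have hab' : (a : F) * b' ∈ Algebra.adjoin S ({t} : Set F) := Subalgebra.mul_mem _ a.2 hb'mem
    obtain ⟨g, hg⟩ : (a : F) * b' ∈ (Polynomial.aeval (R := S) t).range :=
      (le_of_eq (Algebra.adjoin_singleton_eq_range_aeval S t)) hab'
    refine ⟨g.map (e : S →+* R), e c', fun h0 => hc'0 (e.injective (h0.trans (map_zero e).symm)), ?_⟩
    have hmap : Polynomial.aeval t (g.map (e : S →+* R)) = Polynomial.aeval t g := by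
      rw [Polynomial.aeval_def, Polynomial.eval₂_map, Polynomial.aeval_def]
      rfl
    refine Eq.trans ?_ hmap.symm
    have hg' : Polynomial.aeval t g = (a : F) * b' := hg
    rw [hg']
    change (a : F) / b * algebraMap S F c' = a * b'
    rw [← hbb', div_mul_eq_mul_div]
    field_simp
  -- local uniformization of the excellent curve `R[t]` along `O`
  obtain ⟨t', ht', hreg⟩ := exists_adjoin_isRegularLocalRing_of_ringKrullDim_eq_one O hexcR hdimR
    hRO hdomR hmon hx hgen
  -- repackage `R[t][t']` as the `S`-subalgebra `S[t, t']`
  set A : Subalgebra S F := Algebra.adjoin S (insert t (t' : Set F)) with hA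
  have heq : A.toSubring = (Algebra.adjoin R.toSubring (insert t (t' : Set F))).toSubring := by
    rw [hA, Algebra.adjoin_eq_ring_closure, Algebra.adjoin_eq_ring_closure]
    congr 1
    ext x
    simp only [Set.mem_union, Set.mem_range]
    constructor
    · rintro (⟨s, rfl⟩ | hx)
      · exact Or.inl ⟨⟨algebraMap S F s, Subalgebra.algebraMap_mem _ s⟩, rfl⟩
      · exact Or.inr hx
    · rintro (⟨⟨y, hy⟩, rfl⟩ | hx)
      · obtain ⟨s, rfl⟩ := Algebra.mem_bot.mp (show y ∈ R from hy)
        exact Or.inl ⟨s, rfl⟩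
      · exact Or.inr hx
  have hAO : A.toSubring ≤ O.toSubring := heq ▸ ht'
  have htA : t ∈ A := Algebra.subset_adjoin (Set.mem_insert _ _)
  have hle : Algebra.adjoin S ({t} : Set F) ≤ A :=
    Algebra.adjoin_mono (Set.singleton_subset_iff.mpr (Set.mem_insert _ _))
  haveI := hfr
  refine ⟨A, hAO, htA, ?_, isFractionRing_subalgebra_of_le _ A hle, ?_⟩
  · rw [hA, ← Finset.coe_insert]
    exact Subalgebra.fg_adjoin_finset _
  · exact (isRegularLocalRing_centre_congr heq hAO ht').mpr hreg

end OverDVR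

section GeomReduced

open Literature.Barriers.ResolutionOfSingularities

/-- STRENGTHENING 3 — **a geometrically reduced (a fortiori `k`-smooth) uniformizing model.**
The crux with the extra conclusion that the model `A` is a geometrically reduced `k`-algebra
(`k̄ ⊗ₖ A` reduced — necessary for `A` to be smooth over `k` at ANY point). -/
def GeomReducedModel (p : ℕ) : Prop :=
  ∀ (k K : Type) [Field k] [CharP k p] [Field K] [Algebra k K] (O : ValuationSubring K)
    (A₀ : Subalgebra k K) (h₀ : A₀.toSubring ≤ O.toSubring) (t : K), A₀.FG → t ^ p ∈ A₀ →
    IsFractionRing (Algebra.adjoin k (insert t (A₀ : Set K))) K →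
    IsRegularLocalRing (Localization.AtPrime (Ideal.comap (Subring.inclusion h₀)
      (IsLocalRing.maximalIdeal O))) →
    ∃ (A : Subalgebra k K) (h : A.toSubring ≤ O.toSubring), A₀ ≤ A ∧ t ∈ A ∧ A.FG ∧
      IsFractionRing A K ∧ IsRegularLocalRing (Localization.AtPrime
        (Ideal.comap (Subring.inclusion h) (IsLocalRing.maximalIdeal O))) ∧
      Algebra.IsGeometricallyReduced k A

/-- **Strengthening 3 is FALSE over imperfect ground fields** (so the crux is right to conclude
REGULAR, not smooth): `k = 𝔽_p(s)`, `K = k(s^{1/p})`, `A₀ = k`, `t = s^{1/p}` (`t^p = s ∈ A₀`,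
`Frac k[t] = K`), `O = K`. Every model containing `k[t] = K` is `K` itself, regular (a field) but
not geometrically reduced over `k` (tree barrier `InseparableBaseChange`: `K ⊗ₖ K` is not reduced,
Liu Ex. 3.2.12). The witness is zero-dimensional (`O` trivial), but the phenomenon persists in
every dimension (replace `K` by `K(x₁,…,x_n)`; Liu Ex. 7.3.15 / Rem. 4.3.34: regular, not smooth)
— it is the printed reason why LU over imperfect `k` is stated with regular models, and why
Temkin's reduction passes through `l`-SMOOTH points of `Nr_L(X')` for a finite purely inseparable
`l/k` rather than through `k`-smooth ones. -/
theorem not_geomReducedModel (p : ℕ) [hp : Fact p.Prime] : ¬ GeomReducedModel p := by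
  classical
  intro H
  let k := baseField p
  let K := extField p
  let t : K := AdjoinRoot.root (insepPoly p)
  have h₀ : (⊥ : Subalgebra k K).toSubring ≤ (⊤ : ValuationSubring K).toSubring :=
    fun _ _ => Subring.mem_top _
  have hreg : IsRegularLocalRing (Localization.AtPrime (Ideal.comap (Subring.inclusion h₀)
      (IsLocalRing.maximalIdeal (⊤ : ValuationSubring K)))) := by
    haveI : IsNoetherianRing (⊥ : Subalgebra k K).toSubring :=
      isNoetherianRing_of_fg Subalgebra.fg_bot
    exact isRegularLocalRing_localization_of_eq_bot _ (centre_top_eq_bot _ h₀)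
  have htp : t ^ p ∈ (⊥ : Subalgebra k K) := by
    rw [root_pow_eq p]
    exact Subalgebra.algebraMap_mem _ _
  have htop : Algebra.adjoin k (insert t ((⊥ : Subalgebra k K) : Set K)) = ⊤ :=
    top_le_iff.mp ((AdjoinRoot.adjoinRoot_eq_top (f := insepPoly p)).symm.le.trans
      (Algebra.adjoin_mono (Set.singleton_subset_iff.mpr (Set.mem_insert _ _))))
  have hfr : IsFractionRing (Algebra.adjoin k (insert t ((⊥ : Subalgebra k K) : Set K))) K := by
    refine IsFractionRing.of_field _ K fun z => ⟨⟨z, by rw [htop]; trivial⟩, 1, ?_⟩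
    rw [map_one, div_one]
    rfl
  obtain ⟨A, -, -, htA, -, -, -, hgr⟩ := H k K ⊤ ⊥ h₀ t Subalgebra.fg_bot htp hfr hreg
  have hA : A = ⊤ :=
    top_le_iff.mp (htop ▸ Algebra.adjoin_le (by
      rintro x (rfl | hx)
      · exact htA
      · obtain ⟨c, rfl⟩ := Algebra.mem_bot.mp hx
        exact A.algebraMap_mem c))
  subst hA
  haveI := hgr
  exact not_isGeometricallyReduced_extField p
    (Algebra.IsGeometricallyReduced.of_injective
      (Subalgebra.topEquiv (R := k) (A := K)).symm.toAlgHom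
      (Subalgebra.topEquiv (R := k) (A := K)).symm.injective)

end GeomReduced

/-! ## §4d Normalisation does not uniformize: `not_finiteModel` (gen 3)

Infrastructure: monomial valuations of `k(X₀, X₁)` (from `MvPowerSeries.weightedOrder`), balanced
polynomials and the Euler derivation `X₀∂₀ − X₁∂₁` on `𝔽_p[X₀, X₁]`, the `A_{p-1}` witness
`K = 𝔽_p(u^p, v^p, uv)`, and the abstract core `not_isRegularLocalRing_of_values`. -/

open MvPolynomial WithZero

section MonomialValuation

variable {k : Type} [Field k]

/-- The weighted order of a polynomial in two variables for the weights `c`. -/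
def word (c : Fin 2 → ℕ) (f : MvPolynomial (Fin 2) k) : ℕ∞ :=
  (f : MvPowerSeries (Fin 2) k).weightedOrder c

theorem word_eq_top_iff (c : Fin 2 → ℕ) (f : MvPolynomial (Fin 2) k) : word c f = ⊤ ↔ f = 0 := by
  unfold word
  rw [MvPowerSeries.weightedOrder_eq_top_iff, ← MvPolynomial.coe_zero, MvPolynomial.coe_inj]

theorem word_zero (c : Fin 2 → ℕ) : word c (0 : MvPolynomial (Fin 2) k) = ⊤ :=
  (word_eq_top_iff c 0).mpr rfl

theorem word_mul (c : Fin 2 → ℕ) (f g : MvPolynomial (Fin 2) k) :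
    word c (f * g) = word c f + word c g := by
  unfold word
  rw [MvPolynomial.coe_mul]
  exact MvPowerSeries.weightedOrder_mul c _ _

theorem min_word_le_add (c : Fin 2 → ℕ) (f g : MvPolynomial (Fin 2) k) :
    min (word c f) (word c g) ≤ word c (f + g) := by
  unfold word
  rw [MvPolynomial.coe_add]
  exact MvPowerSeries.min_weightedOrder_le_add c

theorem word_monomial (c : Fin 2 → ℕ) (d : Fin 2 →₀ ℕ) {a : k} (ha : a ≠ 0) :
    word c (monomial d a) = (Finsupp.weight c d : ℕ) := by
  unfold word
  rw [MvPolynomial.coe_monomial]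
  exact MvPowerSeries.weightedOrder_monomial_of_ne_zero c ha

theorem word_X (c : Fin 2 → ℕ) (i : Fin 2) : word c (X i : MvPolynomial (Fin 2) k) = (c i : ℕ∞) := by
  rw [MvPolynomial.X, word_monomial c _ one_ne_zero]
  simp [Finsupp.weight_apply, Finsupp.sum_single_index]

theorem word_C (c : Fin 2 → ℕ) {a : k} (ha : a ≠ 0) : word c (C a : MvPolynomial (Fin 2) k) = 0 := by
  rw [← MvPolynomial.monomial_zero', word_monomial c _ ha]
  simp

theorem word_one (c : Fin 2 → ℕ) : word c (1 : MvPolynomial (Fin 2) k) = 0 := by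
  rw [← C_1]; exact word_C c one_ne_zero

/-- A lower bound for the weighted order from vanishing of low coefficients. -/
theorem le_word (c : Fin 2 → ℕ) (f : MvPolynomial (Fin 2) k) (n : ℕ)
    (h : ∀ d : Fin 2 →₀ ℕ, Finsupp.weight c d < n → coeff d f = 0) : (n : ℕ∞) ≤ word c f := by
  unfold word
  refine MvPowerSeries.nat_le_weightedOrder c fun d hd => ?_
  rw [MvPolynomial.coeff_coe]
  exact h d hd

/-- The weighted order as a natural number (junk `0` at `f = 0`). -/
def wnat (c : Fin 2 → ℕ) (f : MvPolynomial (Fin 2) k) : ℕ := (word c f).toNat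

theorem word_eq_wnat (c : Fin 2 → ℕ) {f : MvPolynomial (Fin 2) k} (hf : f ≠ 0) :
    word c f = (wnat c f : ℕ∞) := by
  unfold wnat
  rw [ENat.coe_toNat]
  exact fun h => hf ((word_eq_top_iff c f).mp h)

theorem wnat_mul (c : Fin 2 → ℕ) {f g : MvPolynomial (Fin 2) k} (hf : f ≠ 0) (hg : g ≠ 0) :
    wnat c (f * g) = wnat c f + wnat c g := by
  have hfg : f * g ≠ 0 := mul_ne_zero hf hg
  have := word_mul c f g
  rw [word_eq_wnat c hf, word_eq_wnat c hg, word_eq_wnat c hfg] at this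
  exact_mod_cast this

theorem min_wnat_le_add (c : Fin 2 → ℕ) {f g : MvPolynomial (Fin 2) k} (hf : f ≠ 0) (hg : g ≠ 0)
    (hfg : f + g ≠ 0) : min (wnat c f) (wnat c g) ≤ wnat c (f + g) := by
  have := min_word_le_add c f g
  rw [word_eq_wnat c hf, word_eq_wnat c hg, word_eq_wnat c hfg] at this
  rcases le_total (wnat c f) (wnat c g) with h | h
  · rw [min_eq_left (by exact_mod_cast h : (wnat c f : ℕ∞) ≤ wnat c g)] at this
    rw [min_eq_left h]
    exact_mod_cast this
  · rw [min_eq_right (by exact_mod_cast h : (wnat c g : ℕ∞) ≤ wnat c f)] at this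
    rw [min_eq_right h]
    exact_mod_cast this

open WithZero

open scoped Classical in

/-- The MONOMIAL VALUATION with weights `c` on `k[X₀, X₁]`: `v(f) = exp (−ord_c f)`. -/
def monoVal (c : Fin 2 → ℕ) : Valuation (MvPolynomial (Fin 2) k) ℤᵐ⁰ where
  toFun f := if f = 0 then 0 else exp (-(wnat c f : ℤ))
  map_zero' := by simp
  map_one' := by
    have h1 : (1 : MvPolynomial (Fin 2) k) ≠ 0 := one_ne_zero
    simp only [h1, if_false]
    have : wnat c (1 : MvPolynomial (Fin 2) k) = 0 := by
      have := word_one (k := k) c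
      rw [word_eq_wnat c h1] at this
      exact_mod_cast this
    rw [this]; simp
  map_mul' f g := by
    by_cases hf : f = 0
    · simp [hf]
    by_cases hg : g = 0
    · simp [hg]
    have hfg : f * g ≠ 0 := mul_ne_zero hf hg
    simp only [hf, hg, hfg, if_false, ← exp_add]
    rw [wnat_mul c hf hg]
    push_cast
    ring_nf
  map_add_le_max' f g := by
    by_cases hf : f = 0
    · simp [hf]
    by_cases hg : g = 0
    · simp [hg]
    by_cases hfg : f + g = 0
    · simp [hfg]
    simp only [hf, hg, hfg, if_false]
    have h := min_wnat_le_add c hf hg hfg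
    rw [le_max_iff, exp_le_exp, exp_le_exp]
    rcases min_le_iff.mp h with h | h
    · left; omega
    · right; omega

theorem monoVal_apply (c : Fin 2 → ℕ) {f : MvPolynomial (Fin 2) k} (hf : f ≠ 0) :
    monoVal c f = exp (-(wnat c f : ℤ)) := by
  classical
  change (if f = 0 then (0 : ℤᵐ⁰) else exp (-(wnat c f : ℤ))) = _
  rw [if_neg hf]

theorem monoVal_zero_iff (c : Fin 2 → ℕ) (f : MvPolynomial (Fin 2) k) : monoVal c f = 0 ↔ f = 0 := by
  constructor
  · intro h
    by_contra hf
    rw [monoVal_apply c hf] at h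
    exact WithZero.coe_ne_zero h
  · rintro rfl
    exact (monoVal c).map_zero

theorem monoVal_X (c : Fin 2 → ℕ) (i : Fin 2) :
    monoVal c (X i : MvPolynomial (Fin 2) k) = exp (-(c i : ℤ)) := by
  rw [monoVal_apply c (X_ne_zero i)]
  congr 2
  have := word_X (k := k) c i
  rw [word_eq_wnat c (X_ne_zero i)] at this
  exact_mod_cast this

theorem monoVal_C (c : Fin 2 → ℕ) {a : k} (ha : a ≠ 0) :
    monoVal c (C a : MvPolynomial (Fin 2) k) = 1 := by
  rw [monoVal_apply c ((C_ne_zero (σ := Fin 2)).mpr ha)]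
  have := word_C (k := k) c ha
  rw [word_eq_wnat c ((C_ne_zero (σ := Fin 2)).mpr ha)] at this
  have h0 : wnat c (C a : MvPolynomial (Fin 2) k) = 0 := by exact_mod_cast this
  rw [h0]; simp

/-- `v(f) ≤ exp (−n)` iff every monomial of `f` has weight `≥ n` (for `f ≠ 0`). -/
theorem monoVal_le_exp_neg (c : Fin 2 → ℕ) {f : MvPolynomial (Fin 2) k} (hf : f ≠ 0) (n : ℕ)
    (h : ∀ d : Fin 2 →₀ ℕ, Finsupp.weight c d < n → coeff d f = 0) :
    monoVal c f ≤ exp (-(n : ℤ)) := by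
  rw [monoVal_apply c hf, exp_le_exp, neg_le_neg_iff, Int.ofNat_le]
  have := le_word c f n h
  rw [word_eq_wnat c hf] at this
  exact_mod_cast this

/-- The monomial valuation extended to the fraction field `k(X₀, X₁)`. -/
def monoValFrac (c : Fin 2 → ℕ) : Valuation (FractionRing (MvPolynomial (Fin 2) k)) ℤᵐ⁰ :=
  (monoVal c).extendToLocalization (S := nonZeroDivisors (MvPolynomial (Fin 2) k))
    (fun s hs h => nonZeroDivisors.ne_zero hs
      ((monoVal_zero_iff c s).mp ((Valuation.mem_supp_iff _ _).mp h)))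
    (FractionRing (MvPolynomial (Fin 2) k))

theorem monoValFrac_algebraMap (c : Fin 2 → ℕ) (f : MvPolynomial (Fin 2) k) :
    monoValFrac c (algebraMap _ (FractionRing (MvPolynomial (Fin 2) k)) f) = monoVal c f :=
  Valuation.extendToLocalization_apply_map_apply _ _ _ f

end MonomialValuation

section Balanced

variable (p : ℕ) [hp : Fact p.Prime]

/-- The polynomial ring `𝔽_p[X₀, X₁]`. -/
abbrev B₀ : Type := MvPolynomial (Fin 2) (ZMod p)

/-- The subalgebra `𝔽_p[X₀^p, X₁^p, X₀X₁]` (the `A_{p-1}` ring of invariants). -/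
def invSub : Subalgebra (ZMod p) (B₀ p) :=
  Algebra.adjoin (ZMod p) {X 0 ^ p, X 1 ^ p, X 0 * X 1}

/-- A polynomial is BALANCED if every monomial `X₀^a X₁^b` in its support has `a ≡ b (mod p)`. -/
def Balanced (g : B₀ p) : Prop := ∀ d : Fin 2 →₀ ℕ, coeff d g ≠ 0 → ((d 0 : ℕ) : ZMod p) = (d 1 : ℕ)

/-- The Euler-type derivation `D₀ = X₀ ∂₀ − X₁ ∂₁` of `𝔽_p[X₀, X₁]`. -/
def D₀ : Derivation (ZMod p) (B₀ p) (B₀ p) :=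
  (X 0 : B₀ p) • pderiv 0 - (X 1 : B₀ p) • pderiv 1

theorem D₀_apply (g : B₀ p) : D₀ p g = X 0 * pderiv 0 g - X 1 * pderiv 1 g := by
  unfold D₀
  rw [Derivation.sub_apply, Derivation.smul_apply, Derivation.smul_apply, smul_eq_mul, smul_eq_mul]

theorem X_mul_pderiv_monomial (i : Fin 2) (d : Fin 2 →₀ ℕ) (a : ZMod p) :
    (X i : B₀ p) * pderiv i (monomial d a) = monomial d (a * (d i : ℕ)) := by
  rw [pderiv_monomial]
  by_cases hd : d i = 0
  · simp [hd]
  · have he : Finsupp.single i 1 + (d - Finsupp.single i 1) = d := by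
      ext j
      by_cases hj : i = j
      · subst hj
        simp only [Finsupp.coe_add, Pi.add_apply, Finsupp.single_eq_same, Finsupp.coe_tsub,
          Pi.sub_apply]
        omega
      · simp [hj]
    rw [X, monomial_mul, one_mul, he]

theorem D₀_monomial (d : Fin 2 →₀ ℕ) (a : ZMod p) :
    D₀ p (monomial d a) = monomial d ((((d 0 : ℕ) : ZMod p) - (d 1 : ℕ)) * a) := by
  rw [D₀_apply, X_mul_pderiv_monomial, X_mul_pderiv_monomial, ← map_sub]
  congr 1
  ring

theorem coeff_D₀ (g : B₀ p) (d : Fin 2 →₀ ℕ) :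
    coeff d (D₀ p g) = (((d 0 : ℕ) : ZMod p) - (d 1 : ℕ)) * coeff d g := by
  classical
  conv_lhs => rw [g.as_sum, map_sum]
  simp only [D₀_monomial, coeff_sum, coeff_monomial]
  rw [Finset.sum_ite_eq']
  split_ifs with h
  · rfl
  · rw [notMem_support_iff.mp h, mul_zero]

theorem D₀_eq_zero_iff (g : B₀ p) : D₀ p g = 0 ↔ Balanced p g := by
  constructor
  · intro h d hd
    have := congrArg (coeff d) h
    rw [coeff_D₀, coeff_zero, mul_eq_zero] at this
    rcases this with h1 | h1
    · exact sub_eq_zero.mp h1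
    · exact absurd h1 hd
  · intro h
    ext d
    rw [coeff_D₀, coeff_zero]
    by_cases hd : coeff d g = 0
    · rw [hd, mul_zero]
    · rw [h d hd, sub_self, zero_mul]

/-- `D₀` vanishes on `𝔽_p[X₀^p, X₁^p, X₀X₁]`. -/
theorem D₀_eq_zero_of_mem_invSub {g : B₀ p} (hg : g ∈ invSub p) : D₀ p g = 0 := by
  unfold invSub at hg
  induction hg using Algebra.adjoin_induction with
  | mem x hx =>
    rcases hx with rfl | rfl | rfl
    · rw [X_pow_eq_monomial, D₀_monomial]
      simp
    · rw [X_pow_eq_monomial, D₀_monomial]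
      simp
    · rw [show (X 0 * X 1 : B₀ p) = monomial (Finsupp.single 0 1 + Finsupp.single 1 1) 1 by
        rw [X, X, monomial_mul, one_mul], D₀_monomial]
      simp
  | algebraMap c => exact (D₀ p).map_algebraMap c
  | add x y _ _ hx hy => rw [map_add, hx, hy, add_zero]
  | mul x y _ _ hx hy => rw [Derivation.leibniz, hx, hy, smul_zero, smul_zero, add_zero]

/-- Elements of `𝔽_p[X₀^p, X₁^p, X₀X₁]` are balanced. -/
theorem balanced_of_mem_invSub {g : B₀ p} (hg : g ∈ invSub p) : Balanced p g :=
  (D₀_eq_zero_iff p g).mp (D₀_eq_zero_of_mem_invSub p hg)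

/-- Conversely, balanced polynomials lie in `𝔽_p[X₀^p, X₁^p, X₀X₁]`. -/
theorem mem_invSub_of_balanced {g : B₀ p} (hg : Balanced p g) : g ∈ invSub p := by
  classical
  rw [g.as_sum]
  refine Subalgebra.sum_mem _ fun d hd => ?_
  have hbal : ((d 0 : ℕ) : ZMod p) = (d 1 : ℕ) := hg d (mem_support_iff.mp hd)
  -- `monomial d c = C c * X₀^{d 0} * X₁^{d 1}`
  have hmon : monomial d (coeff d g) =
      C (coeff d g) * (X 0 : B₀ p) ^ (d 0) * (X 1 : B₀ p) ^ (d 1) := by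
    rw [MvPolynomial.monomial_eq, Finsupp.prod_fintype _ _ (by simp), Fin.prod_univ_two, mul_assoc]
  rw [hmon, mul_assoc]
  refine Subalgebra.mul_mem _ (Subalgebra.algebraMap_mem _ _) ?_
  have hgen0 : (X 0 : B₀ p) ^ p ∈ invSub p := Algebra.subset_adjoin (by simp)
  have hgen1 : (X 1 : B₀ p) ^ p ∈ invSub p := Algebra.subset_adjoin (by simp)
  have hgen01 : (X 0 : B₀ p) * X 1 ∈ invSub p := Algebra.subset_adjoin (by simp)
  rcases le_total (d 1) (d 0) with hle | hle
  · -- `d 0 = d 1 + p m`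
    obtain ⟨m, hm⟩ : p ∣ d 0 - d 1 :=
      (ZMod.natCast_eq_zero_iff _ _).mp (by rw [Nat.cast_sub hle, hbal, sub_self])
    have h0 : d 0 = d 1 + p * m := by omega
    rw [h0, pow_add, pow_mul, mul_comm ((X 0 : B₀ p) ^ d 1), mul_assoc, ← mul_pow]
    exact Subalgebra.mul_mem _ (Subalgebra.pow_mem _ hgen0 _) (Subalgebra.pow_mem _ hgen01 _)
  · obtain ⟨m, hm⟩ : p ∣ d 1 - d 0 :=
      (ZMod.natCast_eq_zero_iff _ _).mp (by rw [Nat.cast_sub hle, hbal, sub_self])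
    have h1 : d 1 = d 0 + p * m := by omega
    rw [h1, pow_add, pow_mul, ← mul_assoc, ← mul_pow]
    exact Subalgebra.mul_mem _ (Subalgebra.pow_mem _ hgen01 _) (Subalgebra.pow_mem _ hgen1 _)

/-- If `f · g` and `g ≠ 0` are balanced then so is `f` (Leibniz for `D₀` in the domain
`𝔽_p[X₀, X₁]`). -/
theorem balanced_of_mul {f g : B₀ p} (hg : Balanced p g) (hg0 : g ≠ 0)
    (hfg : Balanced p (f * g)) : Balanced p f := by
  rw [← D₀_eq_zero_iff] at hg hfg ⊢
  have h := (D₀ p).leibniz f g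
  rw [hfg, hg, smul_zero, zero_add, smul_eq_mul] at h
  exact (mul_eq_zero.mp h.symm).resolve_left hg0

end Balanced

section Witness

variable (p : ℕ) [hp : Fact p.Prime]

/-- The ambient field `L = 𝔽_p(u, v)`, fraction field of `𝔽_p[X₀, X₁]`. -/
abbrev LL : Type := FractionRing (B₀ p)

/-- `u = X₀`, `v = X₁` in `L`. -/
def uu : LL p := algebraMap (B₀ p) (LL p) (X 0)
/-- `v = X₁` in `L`. -/
def vv : LL p := algebraMap (B₀ p) (LL p) (X 1)

/-- The generators `x = u^p`, `y = v^p`, `t = uv` of `K`, as elements of `L`. -/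
def xL : LL p := algebraMap (B₀ p) (LL p) (X 0 ^ p)
def yL : LL p := algebraMap (B₀ p) (LL p) (X 1 ^ p)
def tL : LL p := algebraMap (B₀ p) (LL p) (X 0 * X 1)

/-- The field `K = 𝔽_p(u^p, v^p, uv) ⊂ L` (index `p`, `K = L^p(uv)`): fraction field of the
`A_{p-1}`-singularity `t^p = xy`. -/
def Kf : IntermediateField (ZMod p) (LL p) := IntermediateField.adjoin (ZMod p) {xL p, yL p, tL p}

/-- `K` as a type. -/
abbrev Kt : Type := ↥(Kf p)

def xK : Kt p := ⟨xL p, IntermediateField.subset_adjoin _ _ (by simp)⟩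
def yK : Kt p := ⟨yL p, IntermediateField.subset_adjoin _ _ (by simp)⟩
def tK : Kt p := ⟨tL p, IntermediateField.subset_adjoin _ _ (by simp)⟩

@[simp] theorem coe_xK : ((xK p : Kt p) : LL p) = xL p := rfl
@[simp] theorem coe_yK : ((yK p : Kt p) : LL p) = yL p := rfl
@[simp] theorem coe_tK : ((tK p : Kt p) : LL p) = tL p := rfl

theorem tK_pow : tK p ^ p = xK p * yK p := by
  apply Subtype.ext
  simp only [SubmonoidClass.coe_pow, coe_tK, MulMemClass.coe_mul, coe_xK, coe_yK, tL, xL, yL,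
    ← map_pow, ← map_mul, mul_pow]

/-- The base `A₀ = 𝔽_p[x, y] ⊂ K` (a polynomial ring in two variables). -/
def A₀K : Subalgebra (ZMod p) (Kt p) := Algebra.adjoin (ZMod p) {xK p, yK p}

/-- The model `R = A₀[t] = 𝔽_p[x, y, t]`, `t^p = xy`. -/
def RK : Subalgebra (ZMod p) (Kt p) := Algebra.adjoin (ZMod p) (insert (tK p) (A₀K p : Set (Kt p)))

theorem RK_eq : RK p = Algebra.adjoin (ZMod p) {tK p, xK p, yK p} := by
  rw [RK, A₀K, Algebra.adjoin_insert_adjoin]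

theorem tK_pow_mem : tK p ^ p ∈ A₀K p := by
  rw [tK_pow]
  exact Subalgebra.mul_mem _ (Algebra.subset_adjoin (by simp)) (Algebra.subset_adjoin (by simp))

/-- The `𝔽_p`-algebra map `𝔽_p[X₀, X₁] → L`. -/
def toL : B₀ p →ₐ[ZMod p] LL p := IsScalarTower.toAlgHom (ZMod p) (B₀ p) (LL p)

@[simp] theorem toL_apply (g : B₀ p) : toL p g = algebraMap (B₀ p) (LL p) g := rfl

theorem toL_injective : Function.Injective (toL p) := IsFractionRing.injective (B₀ p) (LL p)

/-- The image of `R` in `L` is the image of `𝔽_p[X₀^p, X₁^p, X₀X₁]`. -/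
theorem map_RK : (RK p).map (IntermediateField.val (Kf p)) = (invSub p).map (toL p) := by
  rw [RK_eq, AlgHom.map_adjoin, invSub, AlgHom.map_adjoin]
  congr 1
  ext z
  simp only [Set.image_insert_eq, Set.image_singleton, Set.mem_insert_iff, Set.mem_singleton_iff,
    IntermediateField.coe_val, coe_tK, coe_xK, coe_yK, toL_apply, tL, xL, yL]
  tauto

theorem mem_RK_iff (z : Kt p) : z ∈ RK p ↔ ∃ g ∈ invSub p, algebraMap (B₀ p) (LL p) g = z := by
  constructor
  · intro hz
    have : (z : LL p) ∈ (RK p).map (IntermediateField.val (Kf p)) := ⟨z, hz, rfl⟩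
    rw [map_RK] at this
    obtain ⟨g, hg, hgz⟩ := this
    exact ⟨g, hg, hgz⟩
  · rintro ⟨g, hg, hgz⟩
    have : (z : LL p) ∈ (invSub p).map (toL p) := ⟨g, hg, hgz⟩
    rw [← map_RK] at this
    obtain ⟨z', hz', hzz'⟩ := this
    have : z' = z := Subtype.ext hzz'
    exact this ▸ hz'

/-- `Frac (R) = K`. -/
theorem isFractionRing_RK : IsFractionRing (RK p) (Kt p) := by
  refine IsFractionRing.of_field (RK p) (Kt p) fun z => ?_
  have hz : (z : LL p) ∈ IntermediateField.adjoin (ZMod p) ({xL p, yL p, tL p} : Set (LL p)) := z.2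
  rw [IntermediateField.mem_adjoin_iff_div] at hz
  obtain ⟨r, hr, s, hs, hrs⟩ := hz
  -- `r, s` lie in the image of `R`
  have himg : Algebra.adjoin (ZMod p) {xL p, yL p, tL p} = (RK p).map (IntermediateField.val (Kf p)) := by
    rw [RK_eq, AlgHom.map_adjoin]
    congr 1
    ext w
    simp only [Set.image_insert_eq, Set.image_singleton, Set.mem_insert_iff, Set.mem_singleton_iff,
      IntermediateField.coe_val, coe_tK, coe_xK, coe_yK]
    tauto
  rw [himg] at hr hs
  obtain ⟨r', hr', rfl⟩ := hr
  obtain ⟨s', hs', rfl⟩ := hs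
  refine ⟨⟨r', hr'⟩, ⟨s', hs'⟩, Subtype.ext ?_⟩
  rw [hrs]
  rfl

/-- The base is a polynomial ring: the evaluation `𝔽_p[X₀, X₁] → K`, `Xᵢ ↦ x, y`, is injective
(through `L` it is `g ↦ g^p`). -/
def ψ : B₀ p →ₐ[ZMod p] Kt p := MvPolynomial.aeval ![xK p, yK p]

theorem val_ψ (g : B₀ p) : ((ψ p g : Kt p) : LL p) = algebraMap (B₀ p) (LL p) (g ^ p) := by
  have h1 : (IntermediateField.val (Kf p)).comp (ψ p) =
      (toL p).comp (MvPolynomial.expand p) := by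
    apply MvPolynomial.algHom_ext
    intro i
    fin_cases i
    · simp [ψ, xL, MvPolynomial.expand_X]
    · simp [ψ, yL, MvPolynomial.expand_X]
  have := congrArg (fun φ => φ g) h1
  simp only [AlgHom.coe_comp, Function.comp_apply, IntermediateField.coe_val, toL_apply,
    MvPolynomial.expand_zmod] at this
  exact this

theorem ψ_injective : Function.Injective (ψ p) := by
  intro g₁ g₂ h
  have h' := congrArg (fun z : Kt p => (z : LL p)) h
  simp only [val_ψ] at h'
  have := IsFractionRing.injective (B₀ p) (LL p) h'
  exact frobenius_inj (B₀ p) p this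

theorem range_gen : Set.range ![xK p, yK p] = {xK p, yK p} := by
  ext z
  constructor
  · rintro ⟨i, rfl⟩
    fin_cases i
    · exact Or.inl rfl
    · exact Or.inr rfl
  · rintro (rfl | rfl)
    · exact ⟨0, rfl⟩
    · exact ⟨1, rfl⟩

theorem range_ψ : (ψ p).range = A₀K p := by
  rw [A₀K, ψ, ← Algebra.adjoin_range_eq_range_aeval, range_gen]

/-- `A₀ ≅ 𝔽_p[X₀, X₁]`, hence a regular ring. -/
def ψEquiv : B₀ p ≃ₐ[ZMod p] A₀K p :=
  (AlgEquiv.ofInjective (ψ p) (ψ_injective p)).trans (Subalgebra.equivOfEq _ _ (range_ψ p))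

theorem coe_ψEquiv (g : B₀ p) : ((ψEquiv p g : Kt p) : LL p) = algebraMap (B₀ p) (LL p) (g ^ p) := by
  rw [← val_ψ]
  rfl

instance isRegularRing_A₀K : IsRegularRing (A₀K p) :=
  IsRegularRing.of_ringEquiv (ψEquiv p).toRingEquiv

theorem A₀K_fg : (A₀K p).FG := by
  refine ⟨{xK p, yK p}, ?_⟩
  rw [A₀K, Finset.coe_insert, Finset.coe_singleton]

/-- The valuation of `K` attached to the weights `c` (restriction of the monomial valuation
of `L = 𝔽_p(u, v)` with `v(u) = exp(-c 0)`, `v(v) = exp(-c 1)`). -/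
def vK (c : Fin 2 → ℕ) : Valuation (Kt p) ℤᵐ⁰ :=
  (monoValFrac (k := ZMod p) c).comap (algebraMap (Kt p) (LL p))

/-- Its valuation ring `O_c ⊂ K`; the witness uses `c = (2,1)` for `O` and `c' = (1,p)` as an
auxiliary. -/
def OK (c : Fin 2 → ℕ) : ValuationSubring (Kt p) := (vK p c).valuationSubring

theorem vK_apply (c : Fin 2 → ℕ) (z : Kt p) : vK p c z = monoValFrac c (z : LL p) := rfl

theorem mem_OK_iff (c : Fin 2 → ℕ) (z : Kt p) : z ∈ OK p c ↔ vK p c z ≤ 1 :=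
  Valuation.mem_valuationSubring_iff _ _

theorem vK_of_eq (c : Fin 2 → ℕ) {z : Kt p} {g : B₀ p} (h : algebraMap (B₀ p) (LL p) g = z) :
    vK p c z = monoVal c g := by
  rw [vK_apply, ← h, monoValFrac_algebraMap]

theorem OK_valuation_lt_one_iff (c : Fin 2 → ℕ) (z : Kt p) :
    (OK p c).valuation z < 1 ↔ vK p c z < 1 :=
  (Valuation.isEquiv_valuation_valuationSubring (vK p c)).lt_one_iff_lt_one.symm

theorem OK_valuation_eq_one_iff (c : Fin 2 → ℕ) (z : Kt p) :
    (OK p c).valuation z = 1 ↔ vK p c z = 1 :=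
  (Valuation.isEquiv_valuation_valuationSubring (vK p c)).eq_one_iff_eq_one.symm

theorem vK_xK (c : Fin 2 → ℕ) : vK p c (xK p) = exp (-((p * c 0 : ℕ) : ℤ)) := by
  rw [vK_of_eq p c (z := xK p) (g := X 0 ^ p) rfl, map_pow, monoVal_X, ← exp_nsmul]
  congr 1; push_cast; ring

theorem vK_yK (c : Fin 2 → ℕ) : vK p c (yK p) = exp (-((p * c 1 : ℕ) : ℤ)) := by
  rw [vK_of_eq p c (z := yK p) (g := X 1 ^ p) rfl, map_pow, monoVal_X, ← exp_nsmul]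
  congr 1; push_cast; ring

theorem vK_tK (c : Fin 2 → ℕ) : vK p c (tK p) = exp (-((c 0 + c 1 : ℕ) : ℤ)) := by
  rw [vK_of_eq p c (z := tK p) (g := X 0 * X 1) rfl, map_mul, monoVal_X, monoVal_X, ← exp_add]
  congr 1; push_cast; ring

theorem vK_algebraMap (c : Fin 2 → ℕ) (a : ZMod p) : vK p c (algebraMap (ZMod p) (Kt p) a) ≤ 1 := by
  by_cases ha : a = 0
  · rw [ha, map_zero, Valuation.map_zero]; exact zero_le
  · have h : algebraMap (B₀ p) (LL p) (C a) = ((algebraMap (ZMod p) (Kt p) a : Kt p) : LL p) := by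
      change algebraMap (B₀ p) (LL p) (C a) = algebraMap (Kt p) (LL p) (algebraMap (ZMod p) (Kt p) a)
      rw [← IsScalarTower.algebraMap_apply, ← MvPolynomial.algebraMap_eq,
        ← IsScalarTower.algebraMap_apply]
    rw [vK_of_eq p c h, monoVal_C c ha]

theorem exp_neg_natCast_le_one (n : ℕ) : exp (-(n : ℤ)) ≤ (1 : ℤᵐ⁰) := by
  rw [← exp_zero, exp_le_exp]; omega

/-- `R ⊆ O_c` for every weight vector. -/
theorem RK_le_OK (c : Fin 2 → ℕ) : (RK p).toSubring ≤ (OK p c).toSubring := by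
  have hk : ∀ a : ZMod p, algebraMap (ZMod p) (Kt p) a ∈ OK p c := fun a => by
    rw [mem_OK_iff]; exact vK_algebraMap p c a
  let Oalg : Subalgebra (ZMod p) (Kt p) := { (OK p c).toSubring with algebraMap_mem' := hk }
  change RK p ≤ Oalg
  rw [RK_eq]
  refine Algebra.adjoin_le ?_
  rintro z (rfl | rfl | rfl)
  · change tK p ∈ OK p c
    rw [mem_OK_iff, vK_tK]; exact exp_neg_natCast_le_one _
  · change xK p ∈ OK p c
    rw [mem_OK_iff, vK_xK]; exact exp_neg_natCast_le_one _
  · change yK p ∈ OK p c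
    rw [mem_OK_iff, vK_yK]; exact exp_neg_natCast_le_one _

theorem A₀K_le_RK : A₀K p ≤ RK p := fun _ hz => Algebra.subset_adjoin (Set.mem_insert_of_mem _ hz)

theorem A₀K_le_OK (c : Fin 2 → ℕ) : (A₀K p).toSubring ≤ (OK p c).toSubring :=
  fun _ hz => RK_le_OK p c (A₀K_le_RK p hz)

end Witness

section Estimates

variable (p : ℕ) [hp : Fact p.Prime]

theorem weight_fin_two (c : Fin 2 → ℕ) (d : Fin 2 →₀ ℕ) :
    Finsupp.weight c d = d 0 * c 0 + d 1 * c 1 := by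
  rw [Finsupp.weight_apply, Finsupp.sum_fintype _ _ (by simp), Fin.sum_univ_two, smul_eq_mul,
    smul_eq_mul]

/-- For positive weights: `v(g) = 1` iff `g` has a non-zero constant term. -/
theorem monoVal_eq_one_iff {c : Fin 2 → ℕ} (hc : ∀ i, 0 < c i) {g : B₀ p} (hg : g ≠ 0) :
    monoVal c g = 1 ↔ coeff 0 g ≠ 0 := by
  constructor
  · intro h1 h0
    have hle : monoVal c g ≤ exp (-((1 : ℕ) : ℤ)) := by
      refine monoVal_le_exp_neg c hg 1 fun d hd => ?_
      have hd0 : d = 0 := by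
        rw [weight_fin_two] at hd
        have h0 : d 0 = 0 := by
          have := hc 0; rcases Nat.eq_zero_or_pos (d 0) with h | h
          · exact h
          · exfalso; have : 1 ≤ d 0 * c 0 := Nat.one_le_iff_ne_zero.mpr (by positivity); omega
        have h1' : d 1 = 0 := by
          have := hc 1; rcases Nat.eq_zero_or_pos (d 1) with h | h
          · exact h
          · exfalso; have : 1 ≤ d 1 * c 1 := Nat.one_le_iff_ne_zero.mpr (by positivity); omega
        ext i; fin_cases i <;> simp [h0, h1']
      rw [hd0]; exact h0
    rw [h1, ← exp_zero, exp_le_exp] at hle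
    omega
  · intro h0
    rw [monoVal_apply c hg]
    have hw : word c g = 0 := by
      have := MvPowerSeries.weightedOrder_le (f := (g : MvPowerSeries (Fin 2) (ZMod p))) c
        (d := 0) (by rwa [MvPolynomial.coeff_coe])
      have h0 : (Finsupp.weight c (0 : Fin 2 →₀ ℕ) : ℕ∞) = 0 := by simp
      rw [h0] at this
      exact nonpos_iff_eq_zero.mp this
    rw [word_eq_wnat c hg] at hw
    have : wnat c g = 0 := by exact_mod_cast hw
    rw [this]; simp

/-- The weights of the witness: `v(u) = exp(-2)`, `v(v) = exp(-1)` for `O`. -/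
def cO : Fin 2 → ℕ := ![2, 1]

/-- Auxiliary weights `(1, p)`. -/
def cAux : Fin 2 → ℕ := ![1, p]

theorem cO_pos : ∀ i, 0 < cO i := by
  intro i; fin_cases i <;> simp [cO]

theorem cAux_pos : ∀ i, 0 < cAux p i := by
  intro i; fin_cases i
  · simp [cAux]
  · simpa [cAux] using hp.out.pos

/-- KEY ESTIMATE: a balanced polynomial without constant term has `(1,p)`-weighted order `≥ p`
(its monomials `u^a v^b`, `a ≡ b (p)`, `(a,b) ≠ 0`, have `a + pb ≥ p`). -/
theorem monoVal_cAux_le_of_balanced {g : B₀ p} (hb : Balanced p g) (hg : g ≠ 0)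
    (h0 : coeff 0 g = 0) : monoVal (cAux p) g ≤ exp (-(p : ℤ)) := by
  refine monoVal_le_exp_neg _ hg p fun d hd => ?_
  rw [weight_fin_two] at hd
  simp only [cAux, Matrix.cons_val_zero, Matrix.cons_val_one, mul_one] at hd
  have hd1 : d 1 = 0 := by
    rcases Nat.eq_zero_or_pos (d 1) with h | h
    · exact h
    · exfalso
      have : p ≤ d 1 * p := Nat.le_mul_of_pos_left p h
      omega
  rw [hd1, zero_mul, add_zero] at hd
  by_cases hd0 : d 0 = 0
  · have : d = 0 := by ext i; fin_cases i <;> simp [hd0, hd1]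
    rw [this]; exact h0
  · by_contra hne
    have hbal := hb d hne
    rw [hd1, Nat.cast_zero, ZMod.natCast_eq_zero_iff] at hbal
    exact hd0 (Nat.eq_zero_of_dvd_of_lt hbal hd)

end Estimates

section FiniteModelRefutation

open IsLocalRing Literature.AlgebraicGeometry.Resolution

/-- STRENGTHENING 4 — **a FINITE uniformizing model**: the crux with the extra conclusion that
the model `A` is INTEGRAL over the base `A₀` (equivalently: finite over `A₀[t]`; equivalently
`A` lies in the normalisation of `A₀[t]`). This is what "uniformize by normalising" /
"Temkin's `Nr_L(X)` without the subsequent blow-ups" would give. -/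
def FiniteModel (p : ℕ) : Prop :=
  ∀ (k K : Type) [Field k] [CharP k p] [Field K] [Algebra k K] (O : ValuationSubring K)
    (A₀ : Subalgebra k K) (h₀ : A₀.toSubring ≤ O.toSubring) (t : K), A₀.FG → t ^ p ∈ A₀ →
    IsFractionRing (Algebra.adjoin k (insert t (A₀ : Set K))) K →
    IsRegularLocalRing (Localization.AtPrime (Ideal.comap (Subring.inclusion h₀)
      (IsLocalRing.maximalIdeal O))) →
    ∃ (A : Subalgebra k K) (h : A.toSubring ≤ O.toSubring), A₀ ≤ A ∧ t ∈ A ∧ A.FG ∧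
      IsFractionRing A K ∧ IsRegularLocalRing (Localization.AtPrime
        (Ideal.comap (Subring.inclusion h) (IsLocalRing.maximalIdeal O))) ∧
      ∀ a ∈ A, IsIntegral A₀ a

variable (p : ℕ) [hp : Fact p.Prime]

/-- The ring map `A₀ → 𝔽_p[X₀, X₁]` compatible with `A₀ ⊂ K ⊂ L`: `ψ(g) ↦ g^p`. -/
def ρ : A₀K p →+* B₀ p :=
  (frobenius (B₀ p) p).comp (ψEquiv p).symm.toRingEquiv.toRingHom

theorem algebraMap_ρ (r : A₀K p) : algebraMap (B₀ p) (LL p) (ρ p r) = ((r : Kt p) : LL p) := by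
  obtain ⟨g, rfl⟩ := (ψEquiv p).surjective r
  rw [coe_ψEquiv]
  simp [ρ, frobenius_def]

theorem adjoin_L_eq : Algebra.adjoin (ZMod p) {xL p, yL p, tL p} = (invSub p).map (toL p) := by
  rw [← map_RK, RK_eq, AlgHom.map_adjoin]
  congr 1
  ext w
  simp only [Set.image_insert_eq, Set.image_singleton, Set.mem_insert_iff, Set.mem_singleton_iff,
    IntermediateField.coe_val, coe_tK, coe_xK, coe_yK]
  tauto

/-- **Normality of the `A_{p-1}` ring `R = 𝔽_p[x, y, t]`, `t^p = xy`, in the form needed**: an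
element of `K` integral over `A₀` lies in `R`. (Integral over `A₀` ⇒ integral over the UFD
`𝔽_p[u, v]` ⇒ a polynomial `f` in `u, v`; `f ∈ K` ⇒ `f · s = r` with `r, s` balanced ⇒ `f`
balanced (Leibniz for `u∂ᵤ − v∂ᵥ`) ⇒ `f ∈ 𝔽_p[u^p, v^p, uv] = R`.) -/
theorem mem_RK_of_isIntegral {a : Kt p} (ha : IsIntegral (A₀K p) a) : a ∈ RK p := by
  classical
  -- (i) `a` is integral over `𝔽_p[X₀, X₁]` inside `L`
  have hint : IsIntegral (B₀ p) ((a : Kt p) : LL p) := by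
    obtain ⟨q, hqm, hq⟩ := ha
    refine ⟨q.map (ρ p), hqm.map _, ?_⟩
    have hcomp : (algebraMap (B₀ p) (LL p)).comp (ρ p) =
        (algebraMap (Kt p) (LL p)).comp (algebraMap (A₀K p) (Kt p)) := by
      ext r
      exact algebraMap_ρ p r
    rw [Polynomial.eval₂_map, hcomp]
    change Polynomial.eval₂ _ (algebraMap (Kt p) (LL p) a) q = 0
    rw [← Polynomial.hom_eval₂, hq, map_zero]
  -- (ii) hence a polynomial
  obtain ⟨f, hf⟩ := IsIntegrallyClosed.algebraMap_eq_of_integral hint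
  -- (iii) `a = r / s` with `r, s` in the image of `𝔽_p[u^p, v^p, uv]`
  have haK : ((a : Kt p) : LL p) ∈ IntermediateField.adjoin (ZMod p) ({xL p, yL p, tL p} : Set (LL p)) :=
    a.2
  rw [IntermediateField.mem_adjoin_iff_div] at haK
  obtain ⟨r, hr, s, hs, hrs⟩ := haK
  rw [adjoin_L_eq] at hr hs
  obtain ⟨r', hr', rfl⟩ := hr
  obtain ⟨s', hs', rfl⟩ := hs
  change ((a : Kt p) : LL p) = algebraMap (B₀ p) (LL p) r' / algebraMap (B₀ p) (LL p) s' at hrs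
  by_cases hs0 : s' = 0
  · -- then `a = 0`
    have : ((a : Kt p) : LL p) = 0 := by rw [hrs, hs0, map_zero, div_zero]
    have ha0 : a = 0 := Subtype.ext this
    rw [ha0]; exact Subalgebra.zero_mem _
  -- (iv) `f * s' = r'`, so `f` is balanced, so `f ∈ 𝔽_p[u^p, v^p, uv]`
  have hfs : f * s' = r' := by
    apply IsFractionRing.injective (B₀ p) (LL p)
    rw [map_mul, hf, hrs, div_mul_cancel₀]
    exact fun h => hs0 (IsFractionRing.injective (B₀ p) (LL p) (h.trans (map_zero _).symm))
  have hfbal : Balanced p f :=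
    balanced_of_mul p (balanced_of_mem_invSub p hs') hs0 (hfs ▸ balanced_of_mem_invSub p hr')
  exact (mem_RK_iff p a).mpr ⟨f, mem_invSub_of_balanced p hfbal, hf⟩

/-- Transfer of units: an element of `R` of `(2,1)`-value `1` has `(1,p)`-value `1` (both say:
non-zero constant term). -/
theorem vK_cAux_eq_one {z : Kt p} (hz : z ∈ RK p) (h1 : vK p cO z = 1) : vK p (cAux p) z = 1 := by
  obtain ⟨g, -, hgz⟩ := (mem_RK_iff p z).mp hz
  have hg0 : g ≠ 0 := by
    rintro rfl
    rw [vK_of_eq p cO (z := z) (g := 0) (by simpa using hgz), Valuation.map_zero] at h1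
    exact zero_ne_one h1
  rw [vK_of_eq p cO hgz, monoVal_eq_one_iff p cO_pos hg0] at h1
  rw [vK_of_eq p (cAux p) hgz, monoVal_eq_one_iff p (cAux_pos p) hg0]
  exact h1

/-- An element of `R` of `(2,1)`-value `< 1` has `(1,p)`-value `≤ exp(-p)`. -/
theorem vK_cAux_le {z : Kt p} (hz : z ∈ RK p) (h1 : vK p cO z < 1) :
    vK p (cAux p) z ≤ exp (-(p : ℤ)) := by
  obtain ⟨g, hg, hgz⟩ := (mem_RK_iff p z).mp hz
  by_cases hg0 : g = 0
  · rw [vK_of_eq p (cAux p) hgz, hg0, Valuation.map_zero]; exact zero_le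
  have h0 : coeff 0 g = 0 := by
    by_contra hne
    have := (monoVal_eq_one_iff p cO_pos hg0).mpr hne
    rw [vK_of_eq p cO hgz, this] at h1
    exact lt_irrefl _ h1
  rw [vK_of_eq p (cAux p) hgz]
  exact monoVal_cAux_le_of_balanced p (balanced_of_mem_invSub p hg) hg0 h0

/-- ABSTRACT CORE of the refutation: a model `R ∋ x, y, t` with `t^p = xy`, two valuations `v`
(defining `O`) and `v'` with `v, v' ≤ 1` on `R`, the same units on `R`, `v'(z) ≤ exp(-p)` for
every `z ∈ R` with `v(z) < 1`, `v'(x) = exp(-p)`, and `v(t) > v(x)`: then `R` is NOT regular at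
the centre of `O`. -/
theorem not_isRegularLocalRing_of_values {k K : Type} [Field k] [Field K] [Algebra k K]
    {p : ℕ} (hp0 : p ≠ 0) (O : ValuationSubring K) (R : Subalgebra k K)
    (hRO : R.toSubring ≤ O.toSubring) [IsFractionRing R.toSubring K]
    (v v' : Valuation K ℤᵐ⁰) (hOlt : ∀ z : K, O.valuation z < 1 ↔ v z < 1)
    (hOeq : ∀ z : K, O.valuation z = 1 ↔ v z = 1)
    (hRv : ∀ z ∈ R, v z ≤ 1) (hRv' : ∀ z ∈ R, v' z ≤ 1)
    (hunit : ∀ z ∈ R, v z = 1 → v' z = 1)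
    (hsmall : ∀ z ∈ R, v z < 1 → v' z ≤ exp (-(p : ℤ)))
    {x y t : K} (hx : x ∈ R) (hy : y ∈ R) (ht : t ∈ R) (htp : t ^ p = x * y)
    (hvx : v x < 1) (hv'x : exp (-(2 * p : ℤ)) < v' x) (hvtx : v x < v t)
    (hreg : IsRegularLocalRing (Localization.AtPrime
      ((maximalIdeal O).comap (Subring.inclusion hRO)))) : False := by
  classical
  set 𝔮 : Ideal R.toSubring := (maximalIdeal O).comap (Subring.inclusion hRO) with h𝔮
  set Λ : Subalgebra R.toSubring K := Localization.subalgebra.ofField K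
    𝔮.primeCompl (Ideal.primeCompl_le_nonZeroDivisors _) with hΛ
  haveI hregΛ : IsRegularLocalRing Λ := (isRegularLocalRing_iff_centreLocalization O R hRO).mp hreg
  -- values on `Λ`
  have hΛval : ∀ z : K, z ∈ Λ → v z ≤ 1 ∧ v' z ≤ 1 := by
    intro z hz
    rw [hΛ, mem_centreLocalization_iff] at hz
    obtain ⟨a, ha, s, hs, hs1, rfl⟩ := hz
    rw [hOeq] at hs1
    have hs1' := hunit s hs hs1
    constructor
    · rw [map_mul, map_inv₀, hs1, inv_one, mul_one]; exact hRv a ha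
    · rw [map_mul, map_inv₀, hs1', inv_one, mul_one]; exact hRv' a ha
  -- values on the maximal ideal of `Λ`
  have hmax : ∀ z : Λ, z ∈ maximalIdeal Λ → v' (z : K) ≤ exp (-(p : ℤ)) := by
    intro z hz
    obtain ⟨⟨a, s⟩, rfl⟩ := IsLocalization.mk'_surjective 𝔮.primeCompl z
    have ha : a ∈ 𝔮 := (IsLocalization.AtPrime.mk'_mem_maximal_iff Λ 𝔮 a s).mp hz
    have hs1 : O.valuation (s : K) = 1 := (mem_primeCompl_centre_iff O R hRO s).mp s.2
    rw [hOeq] at hs1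
    have hs1' : v' ((s : R.toSubring) : K) = 1 := hunit _ s.1.2 hs1
    have ha' : v ((a : R.toSubring) : K) < 1 := by
      rw [← hOlt]
      exact (ValuationSubring.valuation_lt_one_iff O _).mp (Ideal.mem_comap.mp ha)
    have hcoe : ((IsLocalization.mk' Λ a s : Λ) : K) * (s : K) = (a : K) :=
      congrArg (fun w : Λ => (w : K)) (IsLocalization.mk'_spec Λ a s)
    have := congrArg v' hcoe
    rw [map_mul, hs1', mul_one] at this
    rw [this]
    exact hsmall _ a.2 ha'
  -- `x ∈ 𝔪 ∖ 𝔪²`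
  set xΛ : Λ := ⟨x, le_centreLocalization O R hRO hx⟩ with hxΛ
  set yΛ : Λ := ⟨y, le_centreLocalization O R hRO hy⟩ with hyΛ
  set tΛ : Λ := ⟨t, le_centreLocalization O R hRO ht⟩ with htΛ
  have hx𝔪 : xΛ ∈ maximalIdeal Λ := by
    have : xΛ = algebraMap R.toSubring Λ ⟨x, hx⟩ := Subtype.ext rfl
    rw [this, IsLocalization.AtPrime.to_map_mem_maximal_iff Λ 𝔮, h𝔮, Ideal.mem_comap,
      ValuationSubring.valuation_lt_one_iff]
    change O.valuation x < 1
    rw [hOlt]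
    exact hvx
  have hx2 : xΛ ∉ maximalIdeal Λ ^ 2 := by
    intro h
    have key : ∀ z ∈ maximalIdeal Λ ^ 2, v' ((z : Λ) : K) ≤ exp (-(2 * p : ℤ)) := by
      intro z hz
      rw [pow_two] at hz
      refine Submodule.mul_induction_on hz (fun m hm n hn => ?_) (fun a b ha hb => ?_)
      · have hmul : ((m * n : Λ) : K) = (m : K) * n := rfl
        rw [hmul, map_mul, show (-(2 * p : ℤ)) = -(p : ℤ) + -(p : ℤ) by ring, exp_add]
        exact mul_le_mul' (hmax m hm) (hmax n hn)
      · have hadd : ((a + b : Λ) : K) = (a : K) + b := rfl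
        rw [hadd]
        exact le_trans (Valuation.map_add _ _ _) (max_le ha hb)
    exact (lt_irrefl _) ((key xΛ h).trans_lt hv'x)
  -- `Λ / xΛ` is regular, hence a domain
  have hsub : ((({xΛ} : Finset Λ) : Set Λ)) ⊆ maximalIdeal Λ := by
    rw [Finset.coe_singleton, Set.singleton_subset_iff]; exact hx𝔪
  have hli : LinearIndependent (ResidueField Λ)
      (fun w : ({xΛ} : Finset Λ) => (maximalIdeal Λ).toCotangent ⟨w, hsub w.2⟩) := by
    haveI : Subsingleton ({xΛ} : Finset Λ) := ⟨fun a b => Subtype.ext (by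
      have ha := Finset.mem_singleton.1 a.2; have hb := Finset.mem_singleton.1 b.2
      rw [ha, hb])⟩
    refine linearIndependent_iff'.2 fun s g hsum i hi => ?_
    have hi' : (i : Λ) = xΛ := Finset.mem_singleton.1 i.2
    have hne : (maximalIdeal Λ).toCotangent ⟨i, hsub i.2⟩ ≠ 0 := by
      rw [Ne, Ideal.toCotangent_eq_zero]
      change (i : Λ) ∉ maximalIdeal Λ ^ 2
      rw [hi']; exact hx2
    have hsum' : ∑ j ∈ s, g j • (maximalIdeal Λ).toCotangent ⟨j, hsub j.2⟩ =
        g i • (maximalIdeal Λ).toCotangent ⟨i, hsub i.2⟩ := by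
      rw [Finset.sum_eq_single_of_mem i hi]
      intro j _ hji
      exact absurd (Subsingleton.elim j i) hji
    rw [hsum'] at hsum
    exact (smul_eq_zero.mp hsum).resolve_right hne
  have hregQ : IsRegularLocalRing (Λ ⧸ Ideal.span {xΛ}) := by
    have h := isRegularLocalRing_quotient_span (R := Λ) {xΛ} hsub hli
    rwa [Finset.coe_singleton] at h
  haveI : IsDomain (Λ ⧸ Ideal.span {xΛ}) := isDomain_of_isRegularLocalRing (Λ ⧸ Ideal.span {xΛ})
  -- `t^p = xy ∈ xΛ` forces `t ∈ xΛ`, i.e. `t = l x` with `l ∈ Λ`, contradicting `v(x) < v(t)`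
  have htpΛ : tΛ ^ p = xΛ * yΛ := Subtype.ext (by
    simp only [SubmonoidClass.coe_pow, MulMemClass.coe_mul]
    exact htp)
  have hmk : Ideal.Quotient.mk (Ideal.span {xΛ}) tΛ = 0 := by
    have hx0 : Ideal.Quotient.mk (Ideal.span {xΛ}) xΛ = 0 :=
      Ideal.Quotient.eq_zero_iff_mem.mpr (Ideal.subset_span (Set.mem_singleton xΛ))
    have h0 : (Ideal.Quotient.mk (Ideal.span {xΛ}) tΛ) ^ p = 0 := by
      rw [← map_pow, htpΛ, map_mul, hx0, zero_mul]
    exact (pow_eq_zero_iff hp0).mp h0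
  rw [Ideal.Quotient.eq_zero_iff_mem, Ideal.mem_span_singleton'] at hmk
  obtain ⟨l, hl⟩ := hmk
  have hlK : t = (l : K) * x := by
    have := congrArg (fun w : Λ => (w : K)) hl
    exact this.symm
  have hl1 : v (l : K) ≤ 1 := (hΛval _ l.2).1
  have := congrArg v hlK
  rw [map_mul] at this
  have hle : v t ≤ v x := by rw [this]; exact mul_le_of_le_one_left' hl1
  exact (lt_irrefl _) (hle.trans_lt hvtx)

set_option maxHeartbeats 800000 in
set_option synthInstance.maxHeartbeats 400000 in
/-- **Strengthening 4 is FALSE for every `p`: normalising does not uniformize; the model must be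
BLOWN UP.** Witness: `k = 𝔽_p`, `A₀ = k[x, y]`, `t^p = xy` (`K = k(u^p, v^p, uv) ⊂ k(u, v)`,
`x = u^p, y = v^p, t = uv`), `O` = the monomial valuation `v(u) = exp(-2)`, `v(v) = exp(-1)`
restricted to `K`. The ring `R = A₀[t] = k[u^p, v^p, uv]` (the `A_{p-1}` singularity) is NORMAL,
so an integral model `A ⊇ R` equals `R`; its local ring `Λ` at the centre `(x, y, t)` is not
regular: `x ∉ 𝔪²` (every element of `𝔪` has `(1,p)`-value `≤ exp(-p)`, so `𝔪²` has value
`≤ exp(-2p) < exp(-p) = v'(x)`), hence `Λ/xΛ` would be regular, hence a domain, but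
`t^p = xy ∈ xΛ` with `t ∉ xΛ` (`v(t/x) = exp(2p-3) > 1`). MORAL: the proof must change the
base / blow up (as in `not_sameModel`), and no "normalisation over the regular base" argument
can close the crux — already for `trdeg 2` and an Abhyankar (monomial, defectless) valuation. -/
theorem not_finiteModel : ¬ FiniteModel p := by
  classical
  intro H
  have hp2 : 2 ≤ p := hp.out.two_le
  -- the base `A₀ = 𝔽_p[x,y]` is regular
  haveI : IsRegularRing (A₀K p).toSubring := isRegularRing_A₀K p
  have hreg₀ : IsRegularLocalRing (Localization.AtPrime (Ideal.comap
      (Subring.inclusion (A₀K_le_OK p cO)) (maximalIdeal (OK p cO)))) := inferInstance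
  obtain ⟨A, hAO, hA₀A, htA, -, -, hreg, hint⟩ :=
    H (ZMod p) (Kt p) (OK p cO) (A₀K p) (A₀K_le_OK p cO) (tK p) (A₀K_fg p) (tK_pow_mem p)
      (isFractionRing_RK p) hreg₀
  -- Step 1: `A = R` by normality
  have hRA : RK p ≤ A := Algebra.adjoin_le (Set.insert_subset_iff.mpr ⟨htA, hA₀A⟩)
  have hAR : A ≤ RK p := fun a ha => mem_RK_of_isIntegral p (hint a ha)
  obtain rfl : A = RK p := le_antisymm hAR hRA
  -- Step 2: the abstract core
  haveI : IsFractionRing (RK p).toSubring (Kt p) := isFractionRing_RK p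
  have hxR : xK p ∈ RK p :=
    Algebra.subset_adjoin (Set.mem_insert_of_mem _ (Algebra.subset_adjoin (by simp)))
  have hyR : yK p ∈ RK p :=
    Algebra.subset_adjoin (Set.mem_insert_of_mem _ (Algebra.subset_adjoin (by simp)))
  have htR : tK p ∈ RK p := Algebra.subset_adjoin (Set.mem_insert _ _)
  refine not_isRegularLocalRing_of_values hp.out.ne_zero (OK p cO) (RK p) hAO (vK p cO)
    (vK p (cAux p)) (OK_valuation_lt_one_iff p cO) (OK_valuation_eq_one_iff p cO)
    (fun z hz => (mem_OK_iff p cO z).mp (RK_le_OK p cO hz))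
    (fun z hz => (mem_OK_iff p (cAux p) z).mp (RK_le_OK p (cAux p) hz))
    (fun z hz h1 => vK_cAux_eq_one p hz h1) (fun z hz h1 => vK_cAux_le p hz h1)
    hxR hyR htR (tK_pow p) ?_ ?_ ?_ hreg
  · rw [vK_xK, ← exp_zero, exp_lt_exp]
    simp [cO]; omega
  · rw [vK_xK, exp_lt_exp]
    simp [cAux]; omega
  · rw [vK_xK, vK_tK, exp_lt_exp]
    simp [cO]; omega

end FiniteModelRefutation



/-! ## §6 TARGETS — the registered line `pbasis-flag-order-p-quotients` (gen 3, 2026-08-16)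

Skeleton registered on the item (planner `…-pbasis-flag-order-p--0`, 2026-08-16T00:01Z, sha 64fc49…):
stubs `stub_inertCover : ∀ p, InertCover p`, `stub_zeroDimReduction : FlagDescentZeroDim p → FlagDescent p`,
`stub_flagDescent : OneStepDescent p → FlagDescentZeroDim p`, `stub_finalForms : FinalForms p` (hardest),
`stub_freeExit : FreeExit p`, `stub_multiplicativeExit : MultiplicativeExit p`. The skeleton file itself is
not readable from the disprover's jail (the planner's `crux write` was refused; only stub NAMES reached the
item), so the kills below are stated against the CARD (`Ideas/pbasis-flag-order-p-quotients.md`) and must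
be re-aimed by the lead at the exact stub bodies. No stub has been broken.

What this file forces on ANY stub of the line that outputs a model (cite by name):
* `not_sameModel` + `not_finiteModel` (§4, §4d): the output model is neither `A₀[t]` nor inside its
  normalisation — the BASE must be blown up (true already in trdeg 1 resp. 2, along Abhyankar
  valuations). A `FreeExit`/`MultiplicativeExit` producing `M^D` must therefore come AFTER base
  blow-ups (`FinalForms`), never from the initial model.
* `not_torsorOverDVR` (§4b): "regular local base + `t^p = a`" is not enough; finite type over a FIELD
  (excellence) must enter — in the card it enters through "`M` finite over `k[M^p]`" (F-finiteness),
  which is exactly what fails for Nagata's DVR. A stub quantifying over abstract regular local rings of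
  characteristic `p` without F-finiteness/excellence is refutable by the §4b witness.
* `conclWithoutFG_of_isDiscreteValuationRing` (§3f): every stub must carry finite generation of the
  model; `M^D` is f.g. only because `M` is finite over the Noetherian `k[M^p] ⊆ M^D` (`k` perfect or
  `[k : k^p] < ∞`).
* `not_geomReducedModel` (§4c) / imperfect `k`: the crux is `∀ k`; a `p`-basis of `K₀/k` has `trdeg`
  elements only when `K₀/k` is separable (e.g. `A₀ = k(s^{1/p})[x]` is regular with `K₀/k`
  inseparable, `[K₀ : kK₀^p] = p²` for `trdeg 1`), so `InertCover`/the flag length must not assume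
  `|p-basis| = n`; conclusions must be REGULAR, not smooth.
* `concl_of_isAbhyankarPlace` (§3d): every stub restricted to Abhyankar valuations is already a theorem;
  the content of `FinalForms` is entirely in NON-Abhyankar (defect-capable) valuations, `trdeg ≥ 4`.

`FinalForms` = MRV¹_ν(n) (free-or-multiplicative final forms of ONE `p`-closed vector field on a regular
model along `ν`) — status in print (read 2026-08-16, Posva arXiv:2405.05735, pages quoted):
* dim 2: a THEOREM — Thm 4.0.1 (p. 19): rank-one 1-foliation on a normal surface over `k = k̄`,
  `∃` projective birational `f : S′ → S`, `S′` regular, `f^*F` with at worst multiplicative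
  singularities (`x∂x + λy∂y`, `λ ∈ 𝔽_p^×`, formal coordinates). Its PROOF runs through Giraud 1983
  (normal form `u = v^p + x^a` of the radicand after blow-ups), i.e. through the torsor side = the
  crux in dim 2: no independent engine.
* dim 3, rank one (the line's "first milestone MRV¹_ν(3)"): `p = 2` SCHEMATIC and global — Thm 5.3.1
  (p. 32; `k` perfect): `X′` regular with `f^*F` REGULAR; `p > 2`: with tame DM STACKS (Thm 5.2.1) or
  with linearly reductive quotient singularities + multiplicative generators (Rem 5.2.2, p. 32); the
  schematic statement is OPEN exactly when `Sing(f^*F)` is a NON-REGULAR curve ("I do not know if we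
  can lift the local generators … A generalization of Proposition 2.3.5 to dimension 3 would give a
  positive answer"). All these proofs consume resolution of threefolds and Cossart 1987 normal forms.
* dim ≥ 4: nothing in print; and in dim 3 the singular locus of a saturated rank-one field is a
  CURVE in general, so "point blow-ups along ν" is not a complete move set: `FinalForms` must quantify
  over regular `D`-stable centres of positive dimension (the card does), and any experiment restricted
  to point blow-ups is void in dim ≥ 3 (verified: kit DFS in dim 3 cycles with period 1 at the
  intersection of the exceptional divisor with the singular curve).
* `p`-closedness is load-bearing in `FreeExit` (paper check): `D = ∂x + x(y∂y − z∂z)` on `k[x,y,z]`,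
  `char k = 2`, is FREE at `0` (`D x = 1`) and not 2-closed (`D² = (x²+1)(y∂y + z∂z)`), and its ring
  of constants is `k[x², y², z², yz] ≅ k[a,b,c,d]/(d² − bc)`: SINGULAR. With `D^p ∈ M·D` the free exit
  is fine (Taylor projector `Σ (−y)^i D^i/i!`, `M = ⊕_{i<p} M^D y^i`, faithfully flat descent).
* COMPUTATION (kit job j009267, exit 0, 59 s; dim 2; `q = p^m` for `(p,m) ∈ {2,3}×{1,2,3} ∪
  {5,7}×{1,2}`; Hamiltonian fields `D_G = G_y∂x − G_x∂y` = the card's `D_{n-1}` for `n = 2`; per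
  `(p,m)` 200 random radicands with NILPOTENT 2-jet (quadratic part `0` or `ℓ²`) + 6 named ones
  (Moh-type `y^p x + x^{p²+1} + y^{p+2}`, Fermat, cuspidal, …); DFS over ALL `𝔽_q`-rational sequences of
  point blow-ups to depth 16 with exact count of the singular points of the saturated transform on each
  exceptional line over `𝔽̄_q`): 2060 fields, 1363 with a BAD (nilpotent) root; EVERY `𝔽_q`-visible
  branch terminates in FREE or MULTIPLICATIVE points — 0 eternal candidates, 0 periodic transforms,
  depth limit never reached (max depth 14: the Moh-type radicand at `p = 7`, whose order stays `7` for
  nine blow-ups before cascading `2,2,1`), 0 extra saturations after a point blow-up (the saturation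
  factor is a pure power of the exceptional variable, as it must be), 191 nodes with singular points
  only over extension fields (not followed; mitigated by the `m = 2, 3` runs). Consistent with Posva
  Thm 4.0.1; the additive cascade is long but finite in every tested case. CAVEAT for re-use: the ROOT
  field must be saturated by the full polynomial gcd (`G = xy(x+y)`, `p = 3`, has `gcd(G_x, G_y) =
  x − y`; monomial content alone fakes an eternal period-3 branch). In dim 3 the same DFS is void
  (singular CURVES: period-1 "cycles" at the curve ∩ exceptional divisor) — curve centres are part of
  the move set there, and nothing was tested.
-/

/-! ## §5 Negative results in print (literature sweep, 2026-08-15)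

Verified on the page (held texts, `lit read`):
* Temkin, *Inseparable local uniformization*, arXiv:0804.1554 = J. Algebra 373 (2013), p. 4,
  Rem. 1.5 (ii): "Multiplying `a_1` by an appropriate `p`-th power we can achieve that `a_1^p ∈ A_0`,
  and then `K°_1` is centered on the model `A_1 = A_0[t]/(t^p − a_1)` of `K_1`. If we know how to
  uniformize valuations on `μ_p`-torsors over regular schemes, then we can uniformize `K°_1`";
  (iii): "local uniformization would follow from local uniformization of hypersurfaces in
  `A^{d+1}` given by equations of the form `t^p = f(x_1..x_d)` … the inseparable case … where all
  'bad things' can happen." — the crux verbatim; NO counterexample is claimed anywhere. Note (ii)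
  assumes `[k : k^p] < ∞` for finiteness of Frobenius; the crux is stated for all `k` with REGULAR
  (not smooth) conclusions, consistent with §3 (`concl_of_trdeg_le_one` holds for every `k`).
* Cutkosky–Mourtada, *Defect and local uniformization*, arXiv:1711.02726 = RACSAM (2019), p. 4:
  "The problem is that we do not know ELU in dimension 4, so we are unable to proceed to LU in
  dimension 4"; "the really essential problem is to prove (state2) [ELU ⇒ LRM] for rank 1
  valuations"; p. 3: all proofs of LU in dim ≥ 3 require embedded LU. — frontier statement, not a
  no-go (tree: `Literature.Barriers.ResolutionOfSingularities.DimensionFourFrontier`).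
* Tree barrier catalogue (`Literature/Barriers/ResolutionOfSingularities/`, 9 topics, all for
  METHODS or STRENGTHENINGS): `ResidualOrderUnbounded*` (Moh 1987 / Hauser–Perlega 2019: residual
  order of `z^{p^e} + F` unbounded under point blow-ups — kills Hironaka-style induction on the
  order, not LU), `KangarooShadeIncrease`, `DirectrixSmallCharacteristic`, `NarasimhanMaximalContact`
  (no maximal contact in char `p`), `ArtinSchreierPuiseux`, `LocalMonomializationFails*`
  (Cutkosky 2014 Thm 1.4: weak local monomialisation fails, defect 2 — a strengthening of LU for
  EXTENSIONS, not LU itself; its §1: "it is of course necessary that some form of resolution of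
  singularities be true"), `InseparableBaseChange*` (regular ≠ smooth over imperfect fields —
  evaded by the crux, which concludes regularity), `QuasiExcellenceNecessary*` (Grothendieck EGA
  IV 7.9.5 + Nagata: resolution forces quasi-excellence; USED in §4b), `DimensionFourFrontier`.
* `ledger negatives --problem ResolutionOfSingularities`: no refuted statement items touching LU.
* Search infrastructure this cycle: `lit search` searchd rc 75 (off-box service down) and
  `lit galaxy` saturated (pdf/crabby queued > 90 s) — the broad sweep for "local uniformization
  counterexample / fails / char p" could NOT be run remotely this cycle (search-degraded; to be
  re-run, nothing concluded from its absence). From the held corpus and the standard literature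
  (Zariski 1940; Abhyankar 1956/66; Lipman 1978; Cossart–Piltant 2008/09/19; Knaf–Kuhlmann 2005/09;
  Temkin 2013; Teissier 2014 (Abhyankar valuations); de Jong 1996 (alterations); Illusie–Laszlo–Orgogozo
  2014 (Gabber, `ℓ'`-alterations)) no counterexample to local uniformization in positive
  characteristic is known or conjectured; the expert consensus treats LU_p as open-and-expected.

CONCLUSION OF THE SWEEP: the crux resists because (§1) it is implied by the summit, (§3) it is
true in every range where resolution is known and in the degenerate directions, and (§4) its
cheap strengthenings are false for reasons (non-excellence; need to change the model) that the
crux's hypotheses exclude by design. -/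

end Summit.ResolutionOfSingularities.ResolutionOfSingularities.Cruxes.LuAlphaPTorsor.Disproof

end
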